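import Literature.Probability.RandomPlanarGeometry.HexSAWSurfaceWallRenewalEighthExact
import HarnessLib

/-!
# The wall-renewal mean, visit mean and contact density of the adsorbed honeycomb walk to EIGHTH order:
# `m(y) = 1 + 2/y² + 3/y³ + 11/y⁴ + 30/y⁵ + 73/y⁶ + 211/y⁷ + 513/y⁸ + o(y⁻⁸)`, `V(y) = 1 + 1/y⁴ + 3/y⁵ + 7/y⁶ + 21/y⁷ + 50/y⁸ + o(y⁻⁸)`,
# `½ − ρ(log y) = 1/y² + 3/(2y³) + 3/y⁴ + 15/(2y⁵) + 23/(2y⁶) + 49/(2y⁷) + 35/y⁸ + o(y⁻⁸)`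

`β(y) = wallRate y`; `m(y) = pwbMean y`, `V(y) = pwbVisitMean y` the mean half-length / mean number of surface visits of a wall-renewal block under
Kesten's law `f_s(y) = Λ_{2s}(y)/β(y)^{2s}`; `ρ⁺ = wallRightDensity` the surface contact density («WALL-DENSITY»: `½ − ρ⁺(log y) = (m − V)/(2m)` for
`y > μ⁴`).  Seven orders are in the tree (… «SEVENTH-EXACT-MEAN» #640: `m₇ = 211`, `V₇ = 21`, `d₇ = 49/2`).  With the diagonal `s − v = 8` of the census
COMPLETE (`N₉,₁ = 98`, `N₁₀,₂ = 99` «CENSUS-EIGHT-A»; `N₁₁,₃ = 33` «CENSUS-EIGHT-B2»; `N₁₂,₄ = 1` «SIX-STEP-RIGIDITY»/«A7-EXACT») this module adds the EIGHTH: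

* §1 laws at order eight: `visits ≤ n/2 − 9` on `ipwb n` for `n ≥ 26` (six-step law) ⇒ `f_s ≤ 9^s/y⁹` for `s ≥ 13`; `12f₁₃ + … + 16f₁₇ = O(y⁻⁹)`;
  `9f₁₀`, `10f₁₁`, `11f₁₂` two-sided (`(891y² + 63y³)/β²⁰`, `330y³/β²²`, `11y⁴/β²⁴` plus `O(y⁻⁹)`); the excess series from half-length eighteen and its
  envelope bound `36μ³⁸/(y⁸√y)` (`y ≥ 48`); `lower_eight_pwbMean` / `upper_eight_pwbMean`.
* §2 ★★★ `tendsto_pow_eight_mul_pwbMean_sub : y⁸ E₈(y) → 0`, `E₈ := m − 1 − 2y/β⁶ − 3y/β⁸ − 12y/β¹⁰ − (30y+5y²)/β¹² − (90y+18y²)/β¹⁴ − (266y+77y²)/β¹⁶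
  − (784y+272y²+8y³)/β¹⁸ − (891y²+63y³)/β²⁰ − 330y³/β²² − 11y⁴/β²⁴` (every block of the diagonal `s − v ≤ 8` subtracted: NOTHING of order `y⁻⁸` remains).
* §3 ten term-wise eighth-order corrections (exact polynomial identities in the `β²`-tower `A, Q, P, H, K` and `u = 1/y`, `ring`) and
  ★★★ `tendsto_pow_eight_mul_pwbMean_sub_seven_terms : y⁸(m − 1 − 2/y² − 3/y³ − 11/y⁴ − 30/y⁵ − 73/y⁶ − 211/y⁷) → 513`
  (`513 = 4 + 12 + 60 − 135 − 756 − 616 + 712 + 891 + 330 + 11`); `isEquivalent_pwbMean_sub_seven_terms`.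
* §4 visit-excess laws: the class lower bound `(V − 1)N_{n,V}y^V ≤ Λ^v_n − Λ_n`; `66y³ ≤ (Λ^v − Λ)₂₂ ≤ 3²²y² + 66y³`; `3y⁴ ≤ (Λ^v − Λ)₂₄ ≤ 2·3²⁴y³ + 3y⁴`;
  the envelope from length twenty-six; the series beyond half-length twelve; `pwbVisitMean_sub_one_ge_eight` / `_le_eight`.
* §5 ★★★ `tendsto_pow_eight_mul_pwbVisitMean_sub` (the order-eight visit remainder `→ 0`), seven visit term lemmas,
  ★★★ `tendsto_pow_eight_mul_pwbVisitMean_sub_one_sub : y⁸(V − 1 − 1/y⁴ − 3/y⁵ − 7/y⁶ − 21/y⁷) → 50` (`= 9 − 21 − 88 − 18 + 99 + 66 + 3`).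
* §6 ★★★ `tendsto_pow_eight_mul_density_deficit : y⁸(½ − ρ⁺(log y) − 1/y² − 3/(2y³) − 3/y⁴ − 15/(2y⁵) − 23/(2y⁶) − 49/(2y⁷)) → 35`
  (`2m·X₈ = M₈ − B₈ − 2M₆ − 3M₅ − 6M₄ − 15M₃ − 23M₂ − 49M₁ → 70`), left density, `t`-form, `isEquivalent_density_deficit_eighth`.

Only the SIXTH-order window of `β²` enters the pure forms (through the rung `K`, «EIGHTH-FLOOR»); `a₆`, `a₇` are not needed — as `m₇` needed only `a₄`.

HONEST LABEL.  LANE THEOREM for this model, DERIVED («SEVENTH-EXACT-MEAN» one order up on the completed diagonal-eight census); sources carry `β ∼ √y`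
([BeatonBousquetMelouDeGierDuminilCopinGuttmann2014, §3.1, Prop. 5, p. 10]) and the renewal structure ([MadrasSlade1993, §4.2], [Kesten1963SAW, §4]) only; the
constants `513`, `50`, `35` are computed in this lane (exact rationals `HOME/pub-sawmu-a-p6/g20/m7/cells/tower.py`; term limits and pure heads reproduce
`m₂ … m₇ = 2, 3, 11, 30, 73, 211` as a control) — NEW IN WRITING (modest).  NOT CLAIMED: any rate beyond `o(y⁻⁸)`; order nine (needs the diagonal `s − v = 9`);
anything for `y ≤ μ⁴`; the armchair wall; numerics.  No definitions.
-/

noncomputable section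

namespace Literature.Probability.RandomPlanarGeometry.SAW.HexBW.Wall

open Finset Filter Function
open Literature.Probability.LatticeModels
open _root_.Topology Asymptotics

variable {y : ℝ} {n : ℕ} {ω : ℕ → Site 2}

/-! ### §0  Private helpers -/

/-- `μ² = 2 + √2`. [cite: DuminilCopinSmirnov2012, Theorem 1] -/
private theorem mu_sq_em : hexConnectiveConstant ^ 2 = 2 + Real.sqrt 2 := by
  rw [hexConnectiveConstant_eq_inv, inv_pow]; exact inv_eq_of_mul_eq_one_right hexCriticalFugacity_sq

/-- `4 ≤ μ⁴`. [cite: DuminilCopinSmirnov2012, Theorem 1] -/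
private theorem four_le_mu_four_em : 4 ≤ hexConnectiveConstant ^ 4 := by
  have h2 : 0 ≤ Real.sqrt 2 := Real.sqrt_nonneg 2
  calc (4 : ℝ) ≤ (2 + Real.sqrt 2) ^ 2 := by nlinarith
    _ = hexConnectiveConstant ^ 4 := by rw [← mu_sq_em]; ring

/-- `μ⁴ < 12`. [cite: DuminilCopinSmirnov2012, Theorem 1] -/
private theorem mu_four_lt_twelve_em : hexConnectiveConstant ^ 4 < 12 := by
  have hup : Real.sqrt 2 ≤ 1.41422 := by
    rw [Real.sqrt_le_left (by norm_num)]
    norm_num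
  have h2 : 0 ≤ Real.sqrt 2 := Real.sqrt_nonneg 2
  calc hexConnectiveConstant ^ 4 = (2 + Real.sqrt 2) ^ 2 := by rw [← mu_sq_em]; ring
    _ ≤ (2 + 1.41422) ^ 2 := by gcongr
    _ < 12 := by norm_num

/-- `y ≤ β(y)²` for `y > 0`. [cite: BeatonBousquetMelouDeGierDuminilCopinGuttmann2014, Section 3.1, Proposition 5 (arXiv v5 p. 9)] -/
private theorem le_sq_wallRate_em (hy : 0 < y) : y ≤ wallRate y ^ 2 := by
  have h := pow_le_pow_left₀ (Real.sqrt_nonneg y) (sqrt_le_wallRate hy) 2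
  rwa [Real.sq_sqrt hy.le] at h

/-- `y^k ≤ β(y)^{2k}` for `y > 0`. [cite: BeatonBousquetMelouDeGierDuminilCopinGuttmann2014, Section 3.1, Proposition 5 (arXiv v5 p. 9)] -/
private theorem pow_le_wallRate_pow_em (hy : 0 < y) (k : ℕ) : y ^ k ≤ wallRate y ^ (2 * k) := by
  rw [pow_mul]; exact pow_le_pow_left₀ hy.le (le_sq_wallRate_em hy) k

/-- [folklore] Relabel the limit of a `Tendsto` by an equal constant. -/
private theorem tendsto_of_tendsto_of_eq_em {f : ℝ → ℝ} {L c : ℝ} (h : Tendsto f atTop (𝓝 L)) (e : L = c) :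
    Tendsto f atTop (𝓝 c) := e ▸ h

/-- `θ = μ²/√y ≤ ½` once `y ≥ 48`. [cite: MadrasSlade1993, Section 4.2, remark before (4.2.21) (p. 94)] [cite: DuminilCopinSmirnov2012, Theorem 1] -/
private theorem theta_le_half_em (hy : 48 ≤ y) : hexConnectiveConstant ^ 2 / Real.sqrt y ≤ 1 / 2 := by
  have hy0 : 0 < y := by linarith
  have hs0 : 0 < Real.sqrt y := Real.sqrt_pos.2 hy0
  have hy2 : Real.sqrt y ^ 2 = y := Real.sq_sqrt hy0.le
  have h4 : (2 * hexConnectiveConstant ^ 2) ^ 2 ≤ Real.sqrt y ^ 2 := by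
    rw [hy2]
    have e : (2 * hexConnectiveConstant ^ 2) ^ 2 = 4 * hexConnectiveConstant ^ 4 := by ring
    rw [e]
    have := mu_four_lt_twelve_em
    linarith
  have h2 : 2 * hexConnectiveConstant ^ 2 ≤ Real.sqrt y :=
    (pow_le_pow_iff_left₀ (by positivity) hs0.le two_ne_zero).1 h4
  rw [div_le_iff₀ hs0]
  linarith

/-- `m(y) → 1`. [cite: MadrasSlade1993, Section 4.2, Theorem 4.2.2 (pp. 91–92)] -/
private theorem tendsto_pwbMean_em : Tendsto pwbMean atTop (𝓝 1) := by
  have h0 : Tendsto (fun y : ℝ => y ^ 2 * (pwbMean y - 1) * (y ^ 2)⁻¹) atTop (𝓝 (2 * 0)) :=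
    tendsto_sq_mul_pwbMean_sub_one.mul (tendsto_pow_atTop two_ne_zero).inv_tendsto_atTop
  have h1 : Tendsto (fun y : ℝ => y ^ 2 * (pwbMean y - 1) * (y ^ 2)⁻¹ + 1) atTop (𝓝 (2 * 0 + 1)) := h0.add_const 1
  rw [mul_zero, zero_add] at h1
  refine h1.congr' ?_
  filter_upwards [eventually_gt_atTop (0 : ℝ)] with y hy
  field_simp
  ring

/-- `y·(m(y) − 1) → 0`. [cite: MadrasSlade1993, Section 4.2, Theorem 4.2.2 (pp. 91–92)] -/
private theorem tendsto_mul_pwbMean_sub_one_em : Tendsto (fun y : ℝ => y * (pwbMean y - 1)) atTop (𝓝 0) := by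
  have h := tendsto_sq_mul_pwbMean_sub_one.mul tendsto_inv_atTop_zero
  rw [mul_zero] at h
  refine h.congr' ?_
  filter_upwards [eventually_gt_atTop (0 : ℝ)] with y hy
  field_simp

/-! ### §1  Laws at order eight: the crude bound from half-length thirteen on, `9f₁₀`, `10f₁₁`, `11f₁₂` two-sided, the tail beyond seventeen -/

/-- ★ **`visits ≤ n/2 − 9` on `ipwb n` for `n ≥ 26`** (six-step law). [cite: MadrasSlade1993, Section 4.2, remark before (4.2.21) (p. 94)] -/
theorem visits_le_half_sub_nine (hn : 26 ≤ n) (hω : ω ∈ ipwb n) : visits n ω ≤ n / 2 - 9 := by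
  have h6 := six_mul_visits_le hω (by omega)
  omega

/-- `Λ_n(y) ≤ #(ipwb n)·y^{n/2 − 9}` for `n ≥ 26`, `y ≥ 1`. [cite: MadrasSlade1993, Section 4.2, (4.2.2) (p. 91)] -/
theorem IPWB_le_card_mul_pow_nine (hn : 26 ≤ n) (hy : 1 ≤ y) : IPWB n y ≤ #(ipwb n) * y ^ (n / 2 - 9) := by
  rw [IPWB]
  have h := Finset.sum_le_card_nsmul (ipwb n) (fun ω => y ^ visits n ω) (y ^ (n / 2 - 9)) fun ω hω =>
    pow_le_pow_right₀ hy (visits_le_half_sub_nine hn hω)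
  rwa [nsmul_eq_mul] at h

/-- ★ **`f_s(y) ≤ 9^s/y⁹` for `s ≥ 13`, `y ≥ 1`**. [cite: MadrasSlade1993, Section 1.2, (1.2.3); Section 4.2, (4.2.2), (4.2.4) (p. 91)] -/
theorem pwbLaw_le_nine_pow_div_pow_nine {s : ℕ} (hs : 13 ≤ s) (hy : 1 ≤ y) : pwbLaw y s ≤ 9 ^ s / y ^ 9 := by
  have hy0 : 0 < y := by linarith
  obtain ⟨m, hm⟩ : ∃ m : ℕ, m = 2 * s := ⟨_, rfl⟩
  have e : pwbLaw y s = IPWB m y / wallRate y ^ m := by rw [pwbLaw, hm]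
  rw [e]
  have hden : y ^ s ≤ wallRate y ^ m := by rw [hm]; exact pow_le_wallRate_pow_em hy0 s
  have hc : (#(ipwb m) : ℝ) ≤ 9 ^ s := by
    calc (#(ipwb m) : ℝ) ≤ 3 ^ m := card_ipwb_le_three_pow m
      _ = 9 ^ s := by rw [hm, pow_mul]; norm_num
  calc IPWB m y / wallRate y ^ m ≤ #(ipwb m) * y ^ (m / 2 - 9) / wallRate y ^ m :=
        div_le_div_of_nonneg_right (IPWB_le_card_mul_pow_nine (by omega) hy) (pow_nonneg (wallRate_pos y).le m)
    _ ≤ #(ipwb m) * y ^ (m / 2 - 9) / y ^ s := div_le_div_of_nonneg_left (by positivity) (by positivity) hden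
    _ = #(ipwb m) / y ^ 9 := by
        rw [show m / 2 - 9 = s - 9 by omega, div_eq_div_iff (by positivity) (by positivity)]
        rw [show (#(ipwb m) : ℝ) * y ^ (s - 9) * y ^ 9 = #(ipwb m) * (y ^ (s - 9) * y ^ 9) by ring, ← pow_add,
          show s - 9 + 9 = s by omega]
    _ ≤ 9 ^ s / y ^ 9 := div_le_div_of_nonneg_right hc (by positivity)

/-- ★ **The census-unknown head terms from half-length thirteen to seventeen are `O(y⁻⁹)`**:
`12f₁₃ + 13f₁₄ + 14f₁₅ + 15f₁₆ + 16f₁₇ ≤ 297840586568622246/y⁹` (`= Σ_{s=13}^{17}(s − 1)9^s`), `y ≥ 1`. [cite: MadrasSlade1993, Section 4.2, (4.2.2)–(4.2.5) (p. 91)] -/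
theorem head_twelve_mul_pwbLaw_le (hy : 1 ≤ y) :
    12 * pwbLaw y 13 + 13 * pwbLaw y 14 + 14 * pwbLaw y 15 + 15 * pwbLaw y 16 + 16 * pwbLaw y 17 ≤ 297840586568622246 / y ^ 9 := by
  have hy0 : 0 < y := by linarith
  have h13 := pwbLaw_le_nine_pow_div_pow_nine (s := 13) (by norm_num) hy
  have h14 := pwbLaw_le_nine_pow_div_pow_nine (s := 14) (by norm_num) hy
  have h15 := pwbLaw_le_nine_pow_div_pow_nine (s := 15) (by norm_num) hy
  have h16 := pwbLaw_le_nine_pow_div_pow_nine (s := 16) (by norm_num) hy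
  have h17 := pwbLaw_le_nine_pow_div_pow_nine (s := 17) (by norm_num) hy
  have e : (297840586568622246 : ℝ) / y ^ 9 =
      12 * (9 ^ 13 / y ^ 9) + 13 * (9 ^ 14 / y ^ 9) + 14 * (9 ^ 15 / y ^ 9) + 15 * (9 ^ 16 / y ^ 9) + 16 * (9 ^ 17 / y ^ 9) := by
    norm_num; ring
  rw [e]
  linarith

open Classical in
/-- ★ **`9f₁₀` two-sided**: `(891y² + 63y³)/β²⁰ ≤ 9f₁₀(y) ≤ (891y² + 63y³)/β²⁰ + 31381059609/y⁹` (`Λ₂₀ = N₁₀,₁y + 99y² + 7y³`, «CENSUS-EIGHT-A»; `N₁₀,₁ ≤ 3²⁰`,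
`β²⁰ ≥ y¹⁰`; `y ≥ 1` for the upper bound). [cite: MadrasSlade1993, Section 1.2, (1.2.3); Section 4.2, (4.2.2)–(4.2.5) (p. 91)] [cite: Kesten1963SAW, Section 4] -/
theorem nine_mul_pwbLaw_ten_le_eight (hy : 1 ≤ y) : 9 * pwbLaw y 10 ≤ (891 * y ^ 2 + 63 * y ^ 3) / wallRate y ^ 20 + 31381059609 / y ^ 9 := by
  have hy0 : 0 < y := by linarith
  obtain ⟨m, hm⟩ : ∃ m : ℕ, m = 20 := ⟨_, rfl⟩
  have e : pwbLaw y 10 = IPWB m y / wallRate y ^ m := by rw [pwbLaw, hm]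
  have h20 : wallRate y ^ m = wallRate y ^ 20 := by rw [hm]
  rw [e, IPWB_twenty_eq_ninetyNine hm, h20]
  have hN : (#((ipwb m).filter fun ω => visits m ω = 1) : ℝ) ≤ 3486784401 := by
    calc (#((ipwb m).filter fun ω => visits m ω = 1) : ℝ) ≤ #(ipwb m) := by
          exact_mod_cast Finset.card_le_card (Finset.filter_subset _ _)
      _ ≤ 3 ^ m := card_ipwb_le_three_pow m
      _ = 3486784401 := by rw [hm]; norm_num
  have hden : y ^ 10 ≤ wallRate y ^ 20 := pow_le_wallRate_pow_em hy0 10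
  have hβ : 0 < wallRate y ^ 20 := pow_pos (wallRate_pos y) 20
  have h1 : (#((ipwb m).filter fun ω => visits m ω = 1) : ℝ) * y / wallRate y ^ 20 ≤ 3486784401 * y / y ^ 10 :=
    calc (#((ipwb m).filter fun ω => visits m ω = 1) : ℝ) * y / wallRate y ^ 20 ≤ 3486784401 * y / wallRate y ^ 20 :=
          div_le_div_of_nonneg_right (mul_le_mul_of_nonneg_right hN hy0.le) hβ.le
      _ ≤ 3486784401 * y / y ^ 10 := div_le_div_of_nonneg_left (by positivity) (by positivity) hden
  have e1 : (3486784401 : ℝ) * y / y ^ 10 = 3486784401 / y ^ 9 := by rw [div_eq_div_iff (by positivity) (by positivity)]; ring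
  rw [e1] at h1
  have es : 9 * ((#((ipwb m).filter fun ω => visits m ω = 1) * y + 99 * y ^ 2 + 7 * y ^ 3) / wallRate y ^ 20) =
      9 * ((#((ipwb m).filter fun ω => visits m ω = 1) : ℝ) * y / wallRate y ^ 20) + (891 * y ^ 2 + 63 * y ^ 3) / wallRate y ^ 20 := by
    ring
  have e9 : (31381059609 : ℝ) / y ^ 9 = 9 * (3486784401 / y ^ 9) := by ring
  rw [es, e9]
  linarith

open Classical in
/-- ★ `(891y² + 63y³)/β²⁰ ≤ 9f₁₀(y)` for `y ≥ 0`. [cite: MadrasSlade1993, Section 4.2, (4.2.2) (p. 91)] [cite: Kesten1963SAW, Section 4] -/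
theorem div_le_nine_mul_pwbLaw_ten_eight (hy : 0 ≤ y) : (891 * y ^ 2 + 63 * y ^ 3) / wallRate y ^ 20 ≤ 9 * pwbLaw y 10 := by
  obtain ⟨m, hm⟩ : ∃ m : ℕ, m = 20 := ⟨_, rfl⟩
  have e : pwbLaw y 10 = IPWB m y / wallRate y ^ m := by rw [pwbLaw, hm]
  have h20 : wallRate y ^ m = wallRate y ^ 20 := by rw [hm]
  rw [e, IPWB_twenty_eq_ninetyNine hm, h20]
  have hβ : 0 < wallRate y ^ 20 := pow_pos (wallRate_pos y) 20
  have hN : (0 : ℝ) ≤ (#((ipwb m).filter fun ω => visits m ω = 1) : ℝ) * y / wallRate y ^ 20 :=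
    div_nonneg (mul_nonneg (Nat.cast_nonneg _) hy) hβ.le
  have es : 9 * ((#((ipwb m).filter fun ω => visits m ω = 1) * y + 99 * y ^ 2 + 7 * y ^ 3) / wallRate y ^ 20) =
      9 * ((#((ipwb m).filter fun ω => visits m ω = 1) : ℝ) * y / wallRate y ^ 20) + (891 * y ^ 2 + 63 * y ^ 3) / wallRate y ^ 20 := by
    ring
  rw [es]
  linarith

/-- ★ **`10f₁₁` two-sided**: `330y³/β²² ≤ 10f₁₁(y) ≤ 330y³/β²² + 627621192180/y⁹` (`Λ₂₂ ≤ 3²²(y + y²) + 33y³` by «EIGHTH-CENSUS-IDENTITY» and «CENSUS-EIGHT-B2»;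
`y + y² ≤ 2y²`, `β²² ≥ y¹¹`; `y ≥ 1`). [cite: MadrasSlade1993, Section 1.2, (1.2.3); Section 4.2, (4.2.2)–(4.2.5) (p. 91)] [cite: Kesten1963SAW, Section 4] -/
theorem ten_mul_pwbLaw_eleven_two_sided (hy : 1 ≤ y) :
    330 * y ^ 3 / wallRate y ^ 22 ≤ 10 * pwbLaw y 11 ∧ 10 * pwbLaw y 11 ≤ 330 * y ^ 3 / wallRate y ^ 22 + 627621192180 / y ^ 9 := by
  classical
  have hy0 : 0 < y := by linarith
  obtain ⟨m, hm⟩ : ∃ m : ℕ, m = 22 := ⟨_, rfl⟩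
  have e : pwbLaw y 11 = IPWB m y / wallRate y ^ m := by rw [pwbLaw, hm]
  have h22 : wallRate y ^ m = wallRate y ^ 22 := by rw [hm]
  rw [e, h22]
  have hβ : 0 < wallRate y ^ 22 := pow_pos (wallRate_pos y) 22
  have hup := IPWB_twentytwo_le_census hm hy0.le
  have hlo := card_filter_visits_mul_pow_le_IPWB m 3 hy0.le
  rw [card_threeVisit_ipwb_twentytwo_eq_thirtyThree hm] at hup hlo
  push_cast at hup hlo
  have hden : y ^ 11 ≤ wallRate y ^ 22 := pow_le_wallRate_pow_em hy0 11
  have hyy : y ≤ y ^ 2 := by nlinarith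
  constructor
  · have h1 : 33 * y ^ 3 / wallRate y ^ 22 ≤ IPWB m y / wallRate y ^ 22 := div_le_div_of_nonneg_right hlo hβ.le
    have e1 : 330 * y ^ 3 / wallRate y ^ 22 = 10 * (33 * y ^ 3 / wallRate y ^ 22) := by ring
    rw [e1]
    linarith
  · have h1 : IPWB m y / wallRate y ^ 22 ≤ (3 ^ 22 * (2 * y ^ 2) + 33 * y ^ 3) / wallRate y ^ 22 :=
      div_le_div_of_nonneg_right (by nlinarith) hβ.le
    have h2 : (3 : ℝ) ^ 22 * (2 * y ^ 2) / wallRate y ^ 22 ≤ 3 ^ 22 * (2 * y ^ 2) / y ^ 11 :=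
      div_le_div_of_nonneg_left (by positivity) (by positivity) hden
    have e2 : (3 : ℝ) ^ 22 * (2 * y ^ 2) / y ^ 11 = 62762119218 / y ^ 9 := by
      rw [div_eq_div_iff (by positivity) (by positivity)]; norm_num; ring
    rw [add_div] at h1
    rw [e2] at h2
    have e10 : (627621192180 : ℝ) / y ^ 9 = 10 * (62762119218 / y ^ 9) := by ring
    have e10' : 330 * y ^ 3 / wallRate y ^ 22 = 10 * (33 * y ^ 3 / wallRate y ^ 22) := by ring
    rw [e10, e10']
    linarith

/-- ★ **`11f₁₂` two-sided**: `11y⁴/β²⁴ ≤ 11f₁₂(y) ≤ 11y⁴/β²⁴ + 9320174703873/y⁹` (`Λ₂₄ ≤ 3²⁴(y + y² + y³) + N₁₂,₄y⁴` with `N₁₂,₄ = 1` by «SIX-STEP-RIGIDITY»;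
`y + y² + y³ ≤ 3y³`, `β²⁴ ≥ y¹²`; `y ≥ 1`). [cite: MadrasSlade1993, Section 1.2, (1.2.3); Section 4.2, (4.2.2)–(4.2.5) (p. 91)] [cite: Kesten1963SAW, Section 4] -/
theorem eleven_mul_pwbLaw_twelve_two_sided (hy : 1 ≤ y) :
    11 * y ^ 4 / wallRate y ^ 24 ≤ 11 * pwbLaw y 12 ∧ 11 * pwbLaw y 12 ≤ 11 * y ^ 4 / wallRate y ^ 24 + 9320174703873 / y ^ 9 := by
  classical
  have hy0 : 0 < y := by linarith
  obtain ⟨m, hm⟩ : ∃ m : ℕ, m = 24 := ⟨_, rfl⟩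
  have e : pwbLaw y 12 = IPWB m y / wallRate y ^ m := by rw [pwbLaw, hm]
  have h24 : wallRate y ^ m = wallRate y ^ 24 := by rw [hm]
  rw [e, h24]
  have hβ : 0 < wallRate y ^ 24 := pow_pos (wallRate_pos y) 24
  have hup := IPWB_twentyfour_le_census hm hy0.le
  have hlo := card_filter_visits_mul_pow_le_IPWB m 4 hy0.le
  rw [card_fourVisit_ipwb_twentyfour_eq_one hm] at hup hlo
  push_cast at hup hlo
  have hden : y ^ 12 ≤ wallRate y ^ 24 := pow_le_wallRate_pow_em hy0 12
  have hy1 : y ≤ y ^ 3 := by nlinarith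
  have hy2 : y ^ 2 ≤ y ^ 3 := by nlinarith
  constructor
  · have h1 : 1 * y ^ 4 / wallRate y ^ 24 ≤ IPWB m y / wallRate y ^ 24 := div_le_div_of_nonneg_right hlo hβ.le
    have e1 : 11 * y ^ 4 / wallRate y ^ 24 = 11 * (1 * y ^ 4 / wallRate y ^ 24) := by ring
    rw [e1]
    linarith
  · have h1 : IPWB m y / wallRate y ^ 24 ≤ (3 ^ 24 * (3 * y ^ 3) + 1 * y ^ 4) / wallRate y ^ 24 :=
      div_le_div_of_nonneg_right (by nlinarith) hβ.le
    have h2 : (3 : ℝ) ^ 24 * (3 * y ^ 3) / wallRate y ^ 24 ≤ 3 ^ 24 * (3 * y ^ 3) / y ^ 12 :=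
      div_le_div_of_nonneg_left (by positivity) (by positivity) hden
    have e2 : (3 : ℝ) ^ 24 * (3 * y ^ 3) / y ^ 12 = 847288609443 / y ^ 9 := by
      rw [div_eq_div_iff (by positivity) (by positivity)]; norm_num; ring
    rw [add_div] at h1
    rw [e2] at h2
    have e11 : (9320174703873 : ℝ) / y ^ 9 = 11 * (847288609443 / y ^ 9) := by ring
    have e11' : 11 * y ^ 4 / wallRate y ^ 24 = 11 * (1 * y ^ 4 / wallRate y ^ 24) := by ring
    rw [e11, e11']
    linarith

/-- **Excess decomposition at order eight**: `Σ_{j ≥ 0} (j + 17) f_{j+18}(y) = m(y) − 1 − (2f₃ + 3f₄ + … + 16f₁₇)` (`y > μ⁴`).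
[cite: MadrasSlade1993, Section 4.2, (4.2.4)–(4.2.5) and Theorem 4.2.2 (pp. 91–92)] [cite: Feller1968, XIII.3] -/
theorem hasSum_excess_tail_eighteen (hy : hexConnectiveConstant ^ 4 < y) :
    HasSum (fun j : ℕ => ((j : ℝ) + 17) * pwbLaw y (j + 18))
      (pwbMean y - 1 - (2 * pwbLaw y 3 + 3 * pwbLaw y 4 + 4 * pwbLaw y 5 + 5 * pwbLaw y 6 + 6 * pwbLaw y 7 + 7 * pwbLaw y 8 +
        8 * pwbLaw y 9 + 9 * pwbLaw y 10 + 10 * pwbLaw y 11 + 11 * pwbLaw y 12 + 12 * pwbLaw y 13 + 13 * pwbLaw y 14 +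
        14 * pwbLaw y 15 + 15 * pwbLaw y 16 + 16 * pwbLaw y 17)) := by
  have ht := (hasSum_nat_add_iff' 2).2 (hasSum_excess_tail_sixteen hy)
  have hsum : ∑ i ∈ Finset.range 2, ((i : ℝ) + 15) * pwbLaw y (i + 16) = 15 * pwbLaw y 16 + 16 * pwbLaw y 17 := by
    simp only [Finset.sum_range_succ, Finset.sum_range_zero]
    push_cast
    ring
  rw [hsum] at ht
  have e : pwbMean y - 1 - (2 * pwbLaw y 3 + 3 * pwbLaw y 4 + 4 * pwbLaw y 5 + 5 * pwbLaw y 6 + 6 * pwbLaw y 7 + 7 * pwbLaw y 8 +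
        8 * pwbLaw y 9 + 9 * pwbLaw y 10 + 10 * pwbLaw y 11 + 11 * pwbLaw y 12 + 12 * pwbLaw y 13 + 13 * pwbLaw y 14 +
        14 * pwbLaw y 15 + 15 * pwbLaw y 16 + 16 * pwbLaw y 17) =
      pwbMean y - 1 - (2 * pwbLaw y 3 + 3 * pwbLaw y 4 + 4 * pwbLaw y 5 + 5 * pwbLaw y 6 + 6 * pwbLaw y 7 + 7 * pwbLaw y 8 +
        8 * pwbLaw y 9 + 9 * pwbLaw y 10 + 10 * pwbLaw y 11 + 11 * pwbLaw y 12 + 12 * pwbLaw y 13 + 13 * pwbLaw y 14 +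
        14 * pwbLaw y 15) - (15 * pwbLaw y 16 + 16 * pwbLaw y 17) := by ring
  rw [e]
  refine ht.congr_fun fun j => ?_
  rw [show j + 2 + 16 = j + 18 by omega]
  push_cast
  ring

/-- ★ **Tail bound at order eight**: for `y ≥ 48`, `m(y) − 1 − (2f₃ + … + 16f₁₇) ≤ 36 μ³⁸/(y⁸√y)` (envelope `f_s ≤ μ²√y θ^s`, `θ ≤ ½`,
`Σ_j (j + 17)θ^j ≤ 2 + 34`, prefactor `μ²√y θ¹⁸ = μ³⁸/(y⁸√y)`). [cite: MadrasSlade1993, Section 4.2, Theorem 4.2.2 and remark before (4.2.21) (pp. 91–94)] [cite: Feller1968, XIII.3] -/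
theorem excess_tail_eighteen_le (hy : 48 ≤ y) :
    pwbMean y - 1 - (2 * pwbLaw y 3 + 3 * pwbLaw y 4 + 4 * pwbLaw y 5 + 5 * pwbLaw y 6 + 6 * pwbLaw y 7 + 7 * pwbLaw y 8 +
        8 * pwbLaw y 9 + 9 * pwbLaw y 10 + 10 * pwbLaw y 11 + 11 * pwbLaw y 12 + 12 * pwbLaw y 13 + 13 * pwbLaw y 14 +
        14 * pwbLaw y 15 + 15 * pwbLaw y 16 + 16 * pwbLaw y 17) ≤
      36 * hexConnectiveConstant ^ 38 / (y ^ 8 * Real.sqrt y) := by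
  have hy0 : 0 < y := by linarith
  have hy1 : 1 ≤ y := by linarith
  have hμ : hexConnectiveConstant ^ 4 < y := mu_four_lt_twelve_em.trans_le (by linarith)
  have hθhalf := theta_le_half_em hy
  have hs0 : 0 < Real.sqrt y := Real.sqrt_pos.2 hy0
  have hμ2 : 0 < hexConnectiveConstant ^ 2 := pow_pos hexConnectiveConstant_pos 2
  have hθ0 : 0 < hexConnectiveConstant ^ 2 / Real.sqrt y := div_pos hμ2 hs0
  have hθ1 : hexConnectiveConstant ^ 2 / Real.sqrt y < 1 := by linarith
  have ht := hasSum_excess_tail_eighteen hμ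
  have hG1 : HasSum (fun j : ℕ => (j : ℝ) * (hexConnectiveConstant ^ 2 / Real.sqrt y) ^ j)
      ((hexConnectiveConstant ^ 2 / Real.sqrt y) / (1 - hexConnectiveConstant ^ 2 / Real.sqrt y) ^ 2) :=
    hasSum_coe_mul_geometric_of_norm_lt_one (by rw [Real.norm_of_nonneg hθ0.le]; exact hθ1)
  have hG0 : HasSum (fun j : ℕ => (hexConnectiveConstant ^ 2 / Real.sqrt y) ^ j)
      (1 - hexConnectiveConstant ^ 2 / Real.sqrt y)⁻¹ := hasSum_geometric_of_lt_one hθ0.le hθ1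
  have hG : HasSum (fun j : ℕ => ((j : ℝ) + 17) *
      (hexConnectiveConstant ^ 2 * Real.sqrt y * (hexConnectiveConstant ^ 2 / Real.sqrt y) ^ (j + 18)))
      (hexConnectiveConstant ^ 2 * Real.sqrt y * (hexConnectiveConstant ^ 2 / Real.sqrt y) ^ 18 *
        ((hexConnectiveConstant ^ 2 / Real.sqrt y) / (1 - hexConnectiveConstant ^ 2 / Real.sqrt y) ^ 2 +
          17 * (1 - hexConnectiveConstant ^ 2 / Real.sqrt y)⁻¹)) := by
    have h := (hG1.add (hG0.mul_left 17)).mul_left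
      (hexConnectiveConstant ^ 2 * Real.sqrt y * (hexConnectiveConstant ^ 2 / Real.sqrt y) ^ 18)
    exact h.congr_fun fun j => by ring
  have hle := hasSum_le (fun j => mul_le_mul_of_nonneg_left (pwbLaw_le_geom hy1 (j + 18)) (by positivity)) ht hG
  set θ := hexConnectiveConstant ^ 2 / Real.sqrt y with hθ_def
  have h1θ : 1 / 2 ≤ 1 - θ := by linarith
  have hinv : (1 - θ)⁻¹ ≤ 2 := by
    rw [inv_le_comm₀ (by linarith) (by norm_num)]
    linarith
  have hq : 1 / 4 ≤ (1 - θ) ^ 2 := by nlinarith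
  have hdiv : θ / (1 - θ) ^ 2 ≤ 2 := by
    rw [div_le_iff₀ (by positivity)]
    linarith
  have hsum : θ / (1 - θ) ^ 2 + 17 * (1 - θ)⁻¹ ≤ 36 := by linarith
  set s := Real.sqrt y with hs_def
  have hys : y = s ^ 2 := (Real.sq_sqrt hy0.le).symm
  have hE0 : 0 ≤ hexConnectiveConstant ^ 2 * s * θ ^ 18 := by positivity
  have hEθ : hexConnectiveConstant ^ 2 * s * θ ^ 18 = hexConnectiveConstant ^ 38 / (y ^ 8 * s) := by
    rw [show y ^ 8 * s = s ^ 17 by rw [hys]; ring, hθ_def, div_pow, ← mul_div_assoc,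
      div_eq_div_iff (pow_ne_zero 18 hs0.ne') (pow_ne_zero 17 hs0.ne')]
    ring
  calc pwbMean y - 1 - (2 * pwbLaw y 3 + 3 * pwbLaw y 4 + 4 * pwbLaw y 5 + 5 * pwbLaw y 6 + 6 * pwbLaw y 7 + 7 * pwbLaw y 8 +
        8 * pwbLaw y 9 + 9 * pwbLaw y 10 + 10 * pwbLaw y 11 + 11 * pwbLaw y 12 + 12 * pwbLaw y 13 + 13 * pwbLaw y 14 +
        14 * pwbLaw y 15 + 15 * pwbLaw y 16 + 16 * pwbLaw y 17)
      ≤ hexConnectiveConstant ^ 2 * s * θ ^ 18 * (θ / (1 - θ) ^ 2 + 17 * (1 - θ)⁻¹) := hle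
    _ ≤ hexConnectiveConstant ^ 2 * s * θ ^ 18 * 36 := mul_le_mul_of_nonneg_left hsum hE0
    _ = 36 * hexConnectiveConstant ^ 38 / (y ^ 8 * s) := by rw [hEθ]; ring

/-- ★★ **Lower bound at order eight** (`y > μ⁴`): `0 ≤ y⁸ E₈(y)`,
`E₈ := m − 1 − 2y/β⁶ − 3y/β⁸ − 12y/β¹⁰ − (30y+5y²)/β¹² − (90y+18y²)/β¹⁴ − (266y+77y²)/β¹⁶ − (784y+272y²+8y³)/β¹⁸ − (891y²+63y³)/β²⁰ − 330y³/β²² − 11y⁴/β²⁴`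
(every block of half-length `≤ 9` explicit — `8f₉ = (784y + 272y² + 8y³)/β¹⁸` by «CENSUS-EIGHT-A» — and the whole diagonal `s − v = 8` subtracted; the rest is `≥ 0`).
[cite: MadrasSlade1993, Section 4.2, (4.2.4)–(4.2.5) and Theorem 4.2.2 (pp. 91–92)] [cite: Kesten1963SAW, Section 4] -/
theorem lower_eight_pwbMean (hy : hexConnectiveConstant ^ 4 < y) :
    0 ≤ y ^ 8 * (pwbMean y - 1 - 2 * y / wallRate y ^ 6 - 3 * y / wallRate y ^ 8 - 12 * y / wallRate y ^ 10 -
        (30 * y + 5 * y ^ 2) / wallRate y ^ 12 - (90 * y + 18 * y ^ 2) / wallRate y ^ 14 - (266 * y + 77 * y ^ 2) / wallRate y ^ 16 -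
        (784 * y + 272 * y ^ 2 + 8 * y ^ 3) / wallRate y ^ 18 - (891 * y ^ 2 + 63 * y ^ 3) / wallRate y ^ 20 -
        330 * y ^ 3 / wallRate y ^ 22 - 11 * y ^ 4 / wallRate y ^ 24) := by
  have hy0 : 0 < y := lt_of_le_of_lt (by positivity) hy
  have hy1 : 1 ≤ y := le_trans (by have := four_le_mu_four_em; linarith) hy.le
  have hnn : 0 ≤ pwbMean y - 1 - (2 * pwbLaw y 3 + 3 * pwbLaw y 4 + 4 * pwbLaw y 5 + 5 * pwbLaw y 6 + 6 * pwbLaw y 7 + 7 * pwbLaw y 8 +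
      8 * pwbLaw y 9 + 9 * pwbLaw y 10 + 10 * pwbLaw y 11 + 11 * pwbLaw y 12 + 12 * pwbLaw y 13) :=
    (hasSum_excess_tail_fourteen hy).nonneg fun j => mul_nonneg (by positivity) (pwbLaw_nonneg hy0.le _)
  have h10 := div_le_nine_mul_pwbLaw_ten_eight hy0.le
  have h11 := (ten_mul_pwbLaw_eleven_two_sided hy1).1
  have h12 := (eleven_mul_pwbLaw_twelve_two_sided hy1).1
  have h13 : 0 ≤ pwbLaw y 13 := pwbLaw_nonneg hy0.le 13
  rw [pwbLaw_three y, pwbLaw_four_eq y, pwbLaw_five_eq y, pwbLaw_six_eq_six y, pwbLaw_seven_eq_exact y, pwbLaw_eight_eq_exact y,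
    pwbLaw_nine_eq_exact y] at hnn
  have hle : 0 ≤ pwbMean y - 1 - 2 * y / wallRate y ^ 6 - 3 * y / wallRate y ^ 8 - 12 * y / wallRate y ^ 10 -
        (30 * y + 5 * y ^ 2) / wallRate y ^ 12 - (90 * y + 18 * y ^ 2) / wallRate y ^ 14 - (266 * y + 77 * y ^ 2) / wallRate y ^ 16 -
        (784 * y + 272 * y ^ 2 + 8 * y ^ 3) / wallRate y ^ 18 - (891 * y ^ 2 + 63 * y ^ 3) / wallRate y ^ 20 -
        330 * y ^ 3 / wallRate y ^ 22 - 11 * y ^ 4 / wallRate y ^ 24 := by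
    have e1 : 2 * y / wallRate y ^ 6 = 2 * (y / wallRate y ^ 6) := by ring
    have e2 : 3 * y / wallRate y ^ 8 = 3 * (y / wallRate y ^ 8) := by ring
    have e3 : 12 * y / wallRate y ^ 10 = 4 * (3 * y / wallRate y ^ 10) := by ring
    have e4 : (30 * y + 5 * y ^ 2) / wallRate y ^ 12 = 5 * ((6 * y + y ^ 2) / wallRate y ^ 12) := by ring
    have e5 : (90 * y + 18 * y ^ 2) / wallRate y ^ 14 = 6 * ((15 * y + 3 * y ^ 2) / wallRate y ^ 14) := by ring
    have e6 : (266 * y + 77 * y ^ 2) / wallRate y ^ 16 = 7 * ((38 * y + 11 * y ^ 2) / wallRate y ^ 16) := by ring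
    have e7 : (784 * y + 272 * y ^ 2 + 8 * y ^ 3) / wallRate y ^ 18 = 8 * ((98 * y + 34 * y ^ 2 + y ^ 3) / wallRate y ^ 18) := by ring
    rw [e1, e2, e3, e4, e5, e6, e7]
    linarith
  exact mul_nonneg (pow_pos hy0 8).le hle

/-- ★★ **Upper bound at order eight** (`y ≥ 48`): `y⁸ E₈(y) ≤ 297850565745577908/y + 36 μ³⁸/√y` (the one-visit twenties, the `≤ 2`-visit twenty-twos,
the `≤ 3`-visit twenty-fours and the half-lengths `13 … 17` by the crude count, the tail beyond seventeen by the envelope).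
[cite: MadrasSlade1993, Section 4.2, (4.2.2)–(4.2.5) and Theorem 4.2.2 (pp. 91–92)] [cite: Kesten1963SAW, Section 4] -/
theorem upper_eight_pwbMean (hy : 48 ≤ y) :
    y ^ 8 * (pwbMean y - 1 - 2 * y / wallRate y ^ 6 - 3 * y / wallRate y ^ 8 - 12 * y / wallRate y ^ 10 -
        (30 * y + 5 * y ^ 2) / wallRate y ^ 12 - (90 * y + 18 * y ^ 2) / wallRate y ^ 14 - (266 * y + 77 * y ^ 2) / wallRate y ^ 16 -
        (784 * y + 272 * y ^ 2 + 8 * y ^ 3) / wallRate y ^ 18 - (891 * y ^ 2 + 63 * y ^ 3) / wallRate y ^ 20 -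
        330 * y ^ 3 / wallRate y ^ 22 - 11 * y ^ 4 / wallRate y ^ 24) ≤
      297850565745577908 / y + 36 * hexConnectiveConstant ^ 38 / Real.sqrt y := by
  have hy0 : 0 < y := by linarith
  have hy1 : 1 ≤ y := by linarith
  have hs0 : 0 < Real.sqrt y := Real.sqrt_pos.2 hy0
  have ht := excess_tail_eighteen_le hy
  have hh := head_twelve_mul_pwbLaw_le hy1
  have h10 := nine_mul_pwbLaw_ten_le_eight hy1
  have h11 := (ten_mul_pwbLaw_eleven_two_sided hy1).2
  have h12 := (eleven_mul_pwbLaw_twelve_two_sided hy1).2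
  rw [pwbLaw_three, pwbLaw_four_eq, pwbLaw_five_eq, pwbLaw_six_eq_six, pwbLaw_seven_eq_exact, pwbLaw_eight_eq_exact, pwbLaw_nine_eq_exact] at ht
  have hle : pwbMean y - 1 - 2 * y / wallRate y ^ 6 - 3 * y / wallRate y ^ 8 - 12 * y / wallRate y ^ 10 -
        (30 * y + 5 * y ^ 2) / wallRate y ^ 12 - (90 * y + 18 * y ^ 2) / wallRate y ^ 14 - (266 * y + 77 * y ^ 2) / wallRate y ^ 16 -
        (784 * y + 272 * y ^ 2 + 8 * y ^ 3) / wallRate y ^ 18 - (891 * y ^ 2 + 63 * y ^ 3) / wallRate y ^ 20 -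
        330 * y ^ 3 / wallRate y ^ 22 - 11 * y ^ 4 / wallRate y ^ 24 ≤
      297850565745577908 / y ^ 9 + 36 * hexConnectiveConstant ^ 38 / (y ^ 8 * Real.sqrt y) := by
    have e1 : 2 * y / wallRate y ^ 6 = 2 * (y / wallRate y ^ 6) := by ring
    have e2 : 3 * y / wallRate y ^ 8 = 3 * (y / wallRate y ^ 8) := by ring
    have e3 : 12 * y / wallRate y ^ 10 = 4 * (3 * y / wallRate y ^ 10) := by ring
    have e4 : (30 * y + 5 * y ^ 2) / wallRate y ^ 12 = 5 * ((6 * y + y ^ 2) / wallRate y ^ 12) := by ring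
    have e5 : (90 * y + 18 * y ^ 2) / wallRate y ^ 14 = 6 * ((15 * y + 3 * y ^ 2) / wallRate y ^ 14) := by ring
    have e6 : (266 * y + 77 * y ^ 2) / wallRate y ^ 16 = 7 * ((38 * y + 11 * y ^ 2) / wallRate y ^ 16) := by ring
    have e7 : (784 * y + 272 * y ^ 2 + 8 * y ^ 3) / wallRate y ^ 18 = 8 * ((98 * y + 34 * y ^ 2 + y ^ 3) / wallRate y ^ 18) := by ring
    have e8 : (297850565745577908 : ℝ) / y ^ 9 =
        31381059609 / y ^ 9 + 627621192180 / y ^ 9 + 9320174703873 / y ^ 9 + 297840586568622246 / y ^ 9 := by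
      rw [← add_div, ← add_div, ← add_div]; norm_num
    rw [e1, e2, e3, e4, e5, e6, e7, e8]
    linarith
  have hm := mul_le_mul_of_nonneg_left hle (pow_pos hy0 8).le
  have f3 : y ^ 8 * (297850565745577908 / y ^ 9) = 297850565745577908 / y := by
    rw [mul_div_assoc', div_eq_div_iff (by positivity) (by positivity)]; ring
  have f4 : y ^ 8 * (36 * hexConnectiveConstant ^ 38 / (y ^ 8 * Real.sqrt y)) = 36 * hexConnectiveConstant ^ 38 / Real.sqrt y := by
    rw [mul_div_assoc', div_eq_div_iff (by positivity) (by positivity)]; ring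
  calc _ ≤ y ^ 8 * (297850565745577908 / y ^ 9 + 36 * hexConnectiveConstant ^ 38 / (y ^ 8 * Real.sqrt y)) := hm
    _ = _ := by rw [mul_add, f3, f4]

/-! ### §2  THE EIGHTH-ORDER REMAINDER VANISHES: `y⁸ E₈(y) → 0` -/

/-- ★★★ **`y⁸ E₈(y) → 0`** (`y → ∞`): once every block of the diagonal `s − v ≤ 8` is subtracted explicitly (they are ALL counted now), nothing of order
`y⁻⁸` remains in the renewal mean. [cite: MadrasSlade1993, Section 4.2, (4.2.5) and Theorem 4.2.2 (pp. 91–92)] [cite: Kesten1963SAW, Section 4] -/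
theorem tendsto_pow_eight_mul_pwbMean_sub :
    Tendsto (fun y : ℝ => y ^ 8 * (pwbMean y - 1 - 2 * y / wallRate y ^ 6 - 3 * y / wallRate y ^ 8 - 12 * y / wallRate y ^ 10 -
        (30 * y + 5 * y ^ 2) / wallRate y ^ 12 - (90 * y + 18 * y ^ 2) / wallRate y ^ 14 - (266 * y + 77 * y ^ 2) / wallRate y ^ 16 -
        (784 * y + 272 * y ^ 2 + 8 * y ^ 3) / wallRate y ^ 18 - (891 * y ^ 2 + 63 * y ^ 3) / wallRate y ^ 20 -
        330 * y ^ 3 / wallRate y ^ 22 - 11 * y ^ 4 / wallRate y ^ 24)) atTop (𝓝 0) := by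
  have h1 : Tendsto (fun y : ℝ => (297850565745577908 : ℝ) / y) atTop (𝓝 0) := tendsto_const_nhds.div_atTop tendsto_id
  have h2 : Tendsto (fun y : ℝ => 36 * hexConnectiveConstant ^ 38 / Real.sqrt y) atTop (𝓝 0) :=
    tendsto_const_nhds.div_atTop Real.tendsto_sqrt_atTop
  have hup : Tendsto (fun y : ℝ => 297850565745577908 / y + 36 * hexConnectiveConstant ^ 38 / Real.sqrt y) atTop (𝓝 0) := by
    simpa using h1.add h2
  refine tendsto_of_tendsto_of_tendsto_of_le_of_le' tendsto_const_nhds hup ?_ ?_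
  · filter_upwards [eventually_gt_atTop (hexConnectiveConstant ^ 4)] with y hy using lower_eight_pwbMean hy
  · filter_upwards [eventually_ge_atTop (48 : ℝ)] with y hy using upper_eight_pwbMean hy

/-! ### §3  THE PURE-POWER FORM: `m(y) = 1 + 2/y² + 3/y³ + 11/y⁴ + 30/y⁵ + 73/y⁶ + 211/y⁷ + 513/y⁸ + o(y⁻⁸)` (needs `β²` only through `6/y⁵`: the sixth rung `K`) -/

/-- **The dip term to eighth order**: `y⁸·(2y/β⁶) − 2y⁶ + 6y⁴ + 6y³ → 4`.
[cite: BeatonBousquetMelouDeGierDuminilCopinGuttmann2014, Section 3.1, Proposition 5 (arXiv v5 p. 9)] [cite: MadrasSlade1993, Section 4.2, (4.2.2) (p. 91)] -/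
theorem tendsto_pow_eight_mul_two_mul_div_sub :
    Tendsto (fun y : ℝ => y ^ 8 * (2 * y / wallRate y ^ 6) - 2 * y ^ 6 + 6 * y ^ 4 + 6 * y ^ 3) atTop (𝓝 4) := by
  have hA := tendsto_sq_mul_one_sub_div_wallRate_sq
  have hQ := tendsto_cube_mul_one_sub_div_sub
  have hP := tendsto_pow_four_mul_one_sub_div_sub
  have hK := tendsto_pow_six_mul_one_sub_div_sub
  have h := (((((hA.pow 3).const_mul ((-2) : ℝ)).add
      ((hQ.pow 2).const_mul (6 : ℝ))).add
      (hP.const_mul (12 : ℝ))).add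
      (hK.const_mul ((-6) : ℝ)))
  refine Tendsto.congr' ?_ (tendsto_of_tendsto_of_eq_em h (by norm_num))
  filter_upwards [eventually_gt_atTop (0 : ℝ)] with y hy
  have hw : wallRate y ≠ 0 := (wallRate_pos y).ne'
  have hy' : y ≠ 0 := hy.ne'
  field_simp
  ring

/-- **The flat-excursion term to eighth order**: `y⁸·(3y/β⁸) − 3y⁵ + 12y³ + 12y² − 6y → 12`.
[cite: BeatonBousquetMelouDeGierDuminilCopinGuttmann2014, Section 3.1, Proposition 5 (arXiv v5 p. 9)] [cite: MadrasSlade1993, Section 4.2, (4.2.2) (p. 91)] -/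
theorem tendsto_pow_eight_mul_three_mul_div_sub :
    Tendsto (fun y : ℝ => y ^ 8 * (3 * y / wallRate y ^ 8) - 3 * y ^ 5 + 12 * y ^ 3 + 12 * y ^ 2 - 6 * y) atTop (𝓝 12) := by
  have hA := tendsto_sq_mul_one_sub_div_wallRate_sq
  have hQ := tendsto_cube_mul_one_sub_div_sub
  have hH := tendsto_pow_five_mul_one_sub_div_sub
  have hu : Tendsto (fun y : ℝ => y⁻¹) atTop (𝓝 0) := tendsto_inv_atTop_zero
  have h := ((((((hA.mul hQ).const_mul (18 : ℝ)).add
      (hQ.const_mul (18 : ℝ))).add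
      (hH.const_mul ((-12) : ℝ))).add
      (((hA.pow 3).mul hu).const_mul ((-12) : ℝ))).add
      (((hA.pow 4).mul (hu.pow 3)).const_mul (3 : ℝ)))
  refine Tendsto.congr' ?_ (tendsto_of_tendsto_of_eq_em h (by norm_num))
  filter_upwards [eventually_gt_atTop (0 : ℝ)] with y hy
  have hw : wallRate y ≠ 0 := (wallRate_pos y).ne'
  have hy' : y ≠ 0 := hy.ne'
  field_simp
  ring

/-- **The tens to eighth order**: `y⁸·(12y/β¹⁰) − 12y⁴ + 60y² + 60y → 60`.
[cite: BeatonBousquetMelouDeGierDuminilCopinGuttmann2014, Section 3.1, Proposition 5 (arXiv v5 p. 9)] [cite: MadrasSlade1993, Section 4.2, (4.2.2) (p. 91)] -/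
theorem tendsto_pow_eight_mul_twelve_mul_div_sub :
    Tendsto (fun y : ℝ => y ^ 8 * (12 * y / wallRate y ^ 10) - 12 * y ^ 4 + 60 * y ^ 2 + 60 * y) atTop (𝓝 60) := by
  have hA := tendsto_sq_mul_one_sub_div_wallRate_sq
  have hP := tendsto_pow_four_mul_one_sub_div_sub
  have hu : Tendsto (fun y : ℝ => y⁻¹) atTop (𝓝 0) := tendsto_inv_atTop_zero
  have h := ((((((hA.pow 2).const_mul (120 : ℝ)).add
      (hP.const_mul ((-60) : ℝ))).add
      (((hA.pow 3).mul (hu.pow 2)).const_mul ((-120) : ℝ))).add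
      (((hA.pow 4).mul (hu.pow 4)).const_mul (60 : ℝ))).add
      (((hA.pow 5).mul (hu.pow 6)).const_mul ((-12) : ℝ)))
  refine Tendsto.congr' ?_ (tendsto_of_tendsto_of_eq_em h (by norm_num))
  filter_upwards [eventually_gt_atTop (0 : ℝ)] with y hy
  have hw : wallRate y ≠ 0 := (wallRate_pos y).ne'
  have hy' : y ≠ 0 := hy.ne'
  field_simp
  ring

/-- **The twelves to eighth order**: `y⁸·((30y + 5y²)/β¹²) − 5y⁴ − 30y³ + 30y² + 210y → −135`.
[cite: BeatonBousquetMelouDeGierDuminilCopinGuttmann2014, Section 3.1, Proposition 5 (arXiv v5 p. 9)] [cite: MadrasSlade1993, Section 4.2, (4.2.2) (p. 91)] -/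
theorem tendsto_pow_eight_mul_twelves_sub :
    Tendsto (fun y : ℝ => y ^ 8 * ((30 * y + 5 * y ^ 2) / wallRate y ^ 12) - 5 * y ^ 4 - 30 * y ^ 3 + 30 * y ^ 2 + 210 * y) atTop (𝓝 (-135)) := by
  have hA := tendsto_sq_mul_one_sub_div_wallRate_sq
  have hQ := tendsto_cube_mul_one_sub_div_sub
  have hP := tendsto_pow_four_mul_one_sub_div_sub
  have hu : Tendsto (fun y : ℝ => y⁻¹) atTop (𝓝 0) := tendsto_inv_atTop_zero
  have h := (((((((((((((hA.pow 2).const_mul (75 : ℝ)).add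
      (hQ.const_mul ((-180) : ℝ))).add
      (hP.const_mul ((-30) : ℝ))).add
      (((hA.pow 2).mul hu).const_mul (450 : ℝ))).add
      (((hA.pow 3).mul (hu.pow 2)).const_mul ((-100) : ℝ))).add
      (((hA.pow 3).mul (hu.pow 3)).const_mul ((-600) : ℝ))).add
      (((hA.pow 4).mul (hu.pow 4)).const_mul (75 : ℝ))).add
      (((hA.pow 4).mul (hu.pow 5)).const_mul (450 : ℝ))).add
      (((hA.pow 5).mul (hu.pow 6)).const_mul ((-30) : ℝ))).add
      (((hA.pow 5).mul (hu.pow 7)).const_mul ((-180) : ℝ))).add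
      (((hA.pow 6).mul (hu.pow 8)).const_mul (5 : ℝ))).add
      (((hA.pow 6).mul (hu.pow 9)).const_mul (30 : ℝ)))
  refine Tendsto.congr' ?_ (tendsto_of_tendsto_of_eq_em h (by norm_num))
  filter_upwards [eventually_gt_atTop (0 : ℝ)] with y hy
  have hw : wallRate y ≠ 0 := (wallRate_pos y).ne'
  have hy' : y ≠ 0 := hy.ne'
  field_simp
  ring

/-- **The fourteens to eighth order**: `y⁸·((90y + 18y²)/β¹⁴) − 18y³ − 90y² + 126y → −756`.
[cite: BeatonBousquetMelouDeGierDuminilCopinGuttmann2014, Section 3.1, Proposition 5 (arXiv v5 p. 9)] [cite: MadrasSlade1993, Section 4.2, (4.2.2) (p. 91)] -/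
theorem tendsto_pow_eight_mul_fourteens_sub :
    Tendsto (fun y : ℝ => y ^ 8 * ((90 * y + 18 * y ^ 2) / wallRate y ^ 14) - 18 * y ^ 3 - 90 * y ^ 2 + 126 * y) atTop (𝓝 (-756)) := by
  have hA := tendsto_sq_mul_one_sub_div_wallRate_sq
  have hQ := tendsto_cube_mul_one_sub_div_sub
  have hu : Tendsto (fun y : ℝ => y⁻¹) atTop (𝓝 0) := tendsto_inv_atTop_zero
  have h := ((((((((((((((hA.const_mul ((-630) : ℝ)).add
      (hQ.const_mul ((-126) : ℝ))).add
      (((hA.pow 2).mul hu).const_mul (378 : ℝ))).add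
      (((hA.pow 2).mul (hu.pow 2)).const_mul (1890 : ℝ))).add
      (((hA.pow 3).mul (hu.pow 3)).const_mul ((-630) : ℝ))).add
      (((hA.pow 3).mul (hu.pow 4)).const_mul ((-3150) : ℝ))).add
      (((hA.pow 4).mul (hu.pow 5)).const_mul (630 : ℝ))).add
      (((hA.pow 4).mul (hu.pow 6)).const_mul (3150 : ℝ))).add
      (((hA.pow 5).mul (hu.pow 7)).const_mul ((-378) : ℝ))).add
      (((hA.pow 5).mul (hu.pow 8)).const_mul ((-1890) : ℝ))).add
      (((hA.pow 6).mul (hu.pow 9)).const_mul (126 : ℝ))).add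
      (((hA.pow 6).mul (hu.pow 10)).const_mul (630 : ℝ))).add
      (((hA.pow 7).mul (hu.pow 11)).const_mul ((-18) : ℝ))).add
      (((hA.pow 7).mul (hu.pow 12)).const_mul ((-90) : ℝ)))
  refine Tendsto.congr' ?_ (tendsto_of_tendsto_of_eq_em h (by norm_num))
  filter_upwards [eventually_gt_atTop (0 : ℝ)] with y hy
  have hw : wallRate y ≠ 0 := (wallRate_pos y).ne'
  have hy' : y ≠ 0 := hy.ne'
  field_simp
  ring

/-- **The sixteens to eighth order**: `y⁸·((266y + 77y²)/β¹⁶) − 77y² − 266y → −616`.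
[cite: BeatonBousquetMelouDeGierDuminilCopinGuttmann2014, Section 3.1, Proposition 5 (arXiv v5 p. 9)] [cite: MadrasSlade1993, Section 4.2, (4.2.2) (p. 91)] -/
theorem tendsto_pow_eight_mul_sixteens_sub :
    Tendsto (fun y : ℝ => y ^ 8 * ((266 * y + 77 * y ^ 2) / wallRate y ^ 16) - 77 * y ^ 2 - 266 * y) atTop (𝓝 (-616)) := by
  have hA := tendsto_sq_mul_one_sub_div_wallRate_sq
  have hu : Tendsto (fun y : ℝ => y⁻¹) atTop (𝓝 0) := tendsto_inv_atTop_zero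
  have h := ((((((((((((((((hA.const_mul ((-616) : ℝ)).add
      ((hA.mul hu).const_mul ((-2128) : ℝ))).add
      (((hA.pow 2).mul (hu.pow 2)).const_mul (2156 : ℝ))).add
      (((hA.pow 2).mul (hu.pow 3)).const_mul (7448 : ℝ))).add
      (((hA.pow 3).mul (hu.pow 4)).const_mul ((-4312) : ℝ))).add
      (((hA.pow 3).mul (hu.pow 5)).const_mul ((-14896) : ℝ))).add
      (((hA.pow 4).mul (hu.pow 6)).const_mul (5390 : ℝ))).add
      (((hA.pow 4).mul (hu.pow 7)).const_mul (18620 : ℝ))).add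
      (((hA.pow 5).mul (hu.pow 8)).const_mul ((-4312) : ℝ))).add
      (((hA.pow 5).mul (hu.pow 9)).const_mul ((-14896) : ℝ))).add
      (((hA.pow 6).mul (hu.pow 10)).const_mul (2156 : ℝ))).add
      (((hA.pow 6).mul (hu.pow 11)).const_mul (7448 : ℝ))).add
      (((hA.pow 7).mul (hu.pow 12)).const_mul ((-616) : ℝ))).add
      (((hA.pow 7).mul (hu.pow 13)).const_mul ((-2128) : ℝ))).add
      (((hA.pow 8).mul (hu.pow 14)).const_mul (77 : ℝ))).add
      (((hA.pow 8).mul (hu.pow 15)).const_mul (266 : ℝ)))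
  refine Tendsto.congr' ?_ (tendsto_of_tendsto_of_eq_em h (by norm_num))
  filter_upwards [eventually_gt_atTop (0 : ℝ)] with y hy
  have hw : wallRate y ≠ 0 := (wallRate_pos y).ne'
  have hy' : y ≠ 0 := hy.ne'
  field_simp
  ring

/-- **The eighteens to eighth order** (`8f₉ = (784y + 272y² + 8y³)/β¹⁸` exactly): `y⁸·((784y + 272y² + 8y³)/β¹⁸) − 8y² − 272y → 712`.
[cite: BeatonBousquetMelouDeGierDuminilCopinGuttmann2014, Section 3.1, Proposition 5 (arXiv v5 p. 9)] [cite: MadrasSlade1993, Section 4.2, (4.2.2) (p. 91)] -/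
theorem tendsto_pow_eight_mul_eighteens_sub :
    Tendsto (fun y : ℝ => y ^ 8 * ((784 * y + 272 * y ^ 2 + 8 * y ^ 3) / wallRate y ^ 18) - 8 * y ^ 2 - 272 * y) atTop (𝓝 712) := by
  have hA := tendsto_sq_mul_one_sub_div_wallRate_sq
  have hu : Tendsto (fun y : ℝ => y⁻¹) atTop (𝓝 0) := tendsto_inv_atTop_zero
  have h := ((((((((((((((((((((((((((((hA.const_mul ((-72) : ℝ)).add
      (tendsto_const_nhds (x := (784 : ℝ)))).add
      ((hA.mul hu).const_mul ((-2448) : ℝ))).add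
      (((hA.pow 2).mul (hu.pow 2)).const_mul (288 : ℝ))).add
      ((hA.mul (hu.pow 2)).const_mul ((-7056) : ℝ))).add
      (((hA.pow 2).mul (hu.pow 3)).const_mul (9792 : ℝ))).add
      (((hA.pow 3).mul (hu.pow 4)).const_mul ((-672) : ℝ))).add
      (((hA.pow 2).mul (hu.pow 4)).const_mul (28224 : ℝ))).add
      (((hA.pow 3).mul (hu.pow 5)).const_mul ((-22848) : ℝ))).add
      (((hA.pow 4).mul (hu.pow 6)).const_mul (1008 : ℝ))).add
      (((hA.pow 3).mul (hu.pow 6)).const_mul ((-65856) : ℝ))).add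
      (((hA.pow 4).mul (hu.pow 7)).const_mul (34272 : ℝ))).add
      (((hA.pow 5).mul (hu.pow 8)).const_mul ((-1008) : ℝ))).add
      (((hA.pow 4).mul (hu.pow 8)).const_mul (98784 : ℝ))).add
      (((hA.pow 5).mul (hu.pow 9)).const_mul ((-34272) : ℝ))).add
      (((hA.pow 6).mul (hu.pow 10)).const_mul (672 : ℝ))).add
      (((hA.pow 5).mul (hu.pow 10)).const_mul ((-98784) : ℝ))).add
      (((hA.pow 6).mul (hu.pow 11)).const_mul (22848 : ℝ))).add
      (((hA.pow 7).mul (hu.pow 12)).const_mul ((-288) : ℝ))).add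
      (((hA.pow 6).mul (hu.pow 12)).const_mul (65856 : ℝ))).add
      (((hA.pow 7).mul (hu.pow 13)).const_mul ((-9792) : ℝ))).add
      (((hA.pow 8).mul (hu.pow 14)).const_mul (72 : ℝ))).add
      (((hA.pow 7).mul (hu.pow 14)).const_mul ((-28224) : ℝ))).add
      (((hA.pow 8).mul (hu.pow 15)).const_mul (2448 : ℝ))).add
      (((hA.pow 9).mul (hu.pow 16)).const_mul ((-8) : ℝ))).add
      (((hA.pow 8).mul (hu.pow 16)).const_mul (7056 : ℝ))).add
      (((hA.pow 9).mul (hu.pow 17)).const_mul ((-272) : ℝ))).add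
      (((hA.pow 9).mul (hu.pow 18)).const_mul ((-784) : ℝ)))
  refine Tendsto.congr' ?_ (tendsto_of_tendsto_of_eq_em h (by norm_num))
  filter_upwards [eventually_gt_atTop (0 : ℝ)] with y hy
  have hw : wallRate y ≠ 0 := (wallRate_pos y).ne'
  have hy' : y ≠ 0 := hy.ne'
  field_simp
  ring

/-- **The two- and three-visit twenties to eighth order**: `y⁸·((891y² + 63y³)/β²⁰) − 63y → 891`.
[cite: BeatonBousquetMelouDeGierDuminilCopinGuttmann2014, Section 3.1, Proposition 5 (arXiv v5 p. 9)] [cite: MadrasSlade1993, Section 4.2, (4.2.2) (p. 91)] -/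
theorem tendsto_pow_eight_mul_twenties_sub :
    Tendsto (fun y : ℝ => y ^ 8 * ((891 * y ^ 2 + 63 * y ^ 3) / wallRate y ^ 20) - 63 * y) atTop (𝓝 891) := by
  have hA := tendsto_sq_mul_one_sub_div_wallRate_sq
  have hu : Tendsto (fun y : ℝ => y⁻¹) atTop (𝓝 0) := tendsto_inv_atTop_zero
  have h := (((((((((((((((((((((tendsto_const_nhds (x := (891 : ℝ))).add
      ((hA.mul hu).const_mul ((-630) : ℝ))).add
      ((hA.mul (hu.pow 2)).const_mul ((-8910) : ℝ))).add
      (((hA.pow 2).mul (hu.pow 3)).const_mul (2835 : ℝ))).add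
      (((hA.pow 2).mul (hu.pow 4)).const_mul (40095 : ℝ))).add
      (((hA.pow 3).mul (hu.pow 5)).const_mul ((-7560) : ℝ))).add
      (((hA.pow 3).mul (hu.pow 6)).const_mul ((-106920) : ℝ))).add
      (((hA.pow 4).mul (hu.pow 7)).const_mul (13230 : ℝ))).add
      (((hA.pow 4).mul (hu.pow 8)).const_mul (187110 : ℝ))).add
      (((hA.pow 5).mul (hu.pow 9)).const_mul ((-15876) : ℝ))).add
      (((hA.pow 5).mul (hu.pow 10)).const_mul ((-224532) : ℝ))).add
      (((hA.pow 6).mul (hu.pow 11)).const_mul (13230 : ℝ))).add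
      (((hA.pow 6).mul (hu.pow 12)).const_mul (187110 : ℝ))).add
      (((hA.pow 7).mul (hu.pow 13)).const_mul ((-7560) : ℝ))).add
      (((hA.pow 7).mul (hu.pow 14)).const_mul ((-106920) : ℝ))).add
      (((hA.pow 8).mul (hu.pow 15)).const_mul (2835 : ℝ))).add
      (((hA.pow 8).mul (hu.pow 16)).const_mul (40095 : ℝ))).add
      (((hA.pow 9).mul (hu.pow 17)).const_mul ((-630) : ℝ))).add
      (((hA.pow 9).mul (hu.pow 18)).const_mul ((-8910) : ℝ))).add
      (((hA.pow 10).mul (hu.pow 19)).const_mul (63 : ℝ))).add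
      (((hA.pow 10).mul (hu.pow 20)).const_mul (891 : ℝ)))
  refine Tendsto.congr' ?_ (tendsto_of_tendsto_of_eq_em h (by norm_num))
  filter_upwards [eventually_gt_atTop (0 : ℝ)] with y hy
  have hw : wallRate y ≠ 0 := (wallRate_pos y).ne'
  have hy' : y ≠ 0 := hy.ne'
  field_simp
  ring

/-- **The three-visit twenty-twos to eighth order**: `y⁸·(330y³/β²²) → 330`.
[cite: BeatonBousquetMelouDeGierDuminilCopinGuttmann2014, Section 3.1, Proposition 5 (arXiv v5 p. 9)] [cite: MadrasSlade1993, Section 4.2, (4.2.2) (p. 91)] -/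
theorem tendsto_pow_eight_mul_twentytwos_sub :
    Tendsto (fun y : ℝ => y ^ 8 * (330 * y ^ 3 / wallRate y ^ 22) ) atTop (𝓝 330) := by
  have hA := tendsto_sq_mul_one_sub_div_wallRate_sq
  have hu : Tendsto (fun y : ℝ => y⁻¹) atTop (𝓝 0) := tendsto_inv_atTop_zero
  have h := ((((((((((((tendsto_const_nhds (x := (330 : ℝ))).add
      ((hA.mul (hu.pow 2)).const_mul ((-3630) : ℝ))).add
      (((hA.pow 2).mul (hu.pow 4)).const_mul (18150 : ℝ))).add
      (((hA.pow 3).mul (hu.pow 6)).const_mul ((-54450) : ℝ))).add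
      (((hA.pow 4).mul (hu.pow 8)).const_mul (108900 : ℝ))).add
      (((hA.pow 5).mul (hu.pow 10)).const_mul ((-152460) : ℝ))).add
      (((hA.pow 6).mul (hu.pow 12)).const_mul (152460 : ℝ))).add
      (((hA.pow 7).mul (hu.pow 14)).const_mul ((-108900) : ℝ))).add
      (((hA.pow 8).mul (hu.pow 16)).const_mul (54450 : ℝ))).add
      (((hA.pow 9).mul (hu.pow 18)).const_mul ((-18150) : ℝ))).add
      (((hA.pow 10).mul (hu.pow 20)).const_mul (3630 : ℝ))).add
      (((hA.pow 11).mul (hu.pow 22)).const_mul ((-330) : ℝ)))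
  refine Tendsto.congr' ?_ (tendsto_of_tendsto_of_eq_em h (by norm_num))
  filter_upwards [eventually_gt_atTop (0 : ℝ)] with y hy
  have hw : wallRate y ≠ 0 := (wallRate_pos y).ne'
  have hy' : y ≠ 0 := hy.ne'
  field_simp
  ring

/-- **The hook `H₄` to eighth order**: `y⁸·(11y⁴/β²⁴) → 11`.
[cite: BeatonBousquetMelouDeGierDuminilCopinGuttmann2014, Section 3.1, Proposition 5 (arXiv v5 p. 9)] [cite: MadrasSlade1993, Section 4.2, (4.2.2) (p. 91)] -/
theorem tendsto_pow_eight_mul_hook_four_sub :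
    Tendsto (fun y : ℝ => y ^ 8 * (11 * y ^ 4 / wallRate y ^ 24) ) atTop (𝓝 11) := by
  have hA := tendsto_sq_mul_one_sub_div_wallRate_sq
  have hu : Tendsto (fun y : ℝ => y⁻¹) atTop (𝓝 0) := tendsto_inv_atTop_zero
  have h := (((((((((((((tendsto_const_nhds (x := (11 : ℝ))).add
      ((hA.mul (hu.pow 2)).const_mul ((-132) : ℝ))).add
      (((hA.pow 2).mul (hu.pow 4)).const_mul (726 : ℝ))).add
      (((hA.pow 3).mul (hu.pow 6)).const_mul ((-2420) : ℝ))).add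
      (((hA.pow 4).mul (hu.pow 8)).const_mul (5445 : ℝ))).add
      (((hA.pow 5).mul (hu.pow 10)).const_mul ((-8712) : ℝ))).add
      (((hA.pow 6).mul (hu.pow 12)).const_mul (10164 : ℝ))).add
      (((hA.pow 7).mul (hu.pow 14)).const_mul ((-8712) : ℝ))).add
      (((hA.pow 8).mul (hu.pow 16)).const_mul (5445 : ℝ))).add
      (((hA.pow 9).mul (hu.pow 18)).const_mul ((-2420) : ℝ))).add
      (((hA.pow 10).mul (hu.pow 20)).const_mul (726 : ℝ))).add
      (((hA.pow 11).mul (hu.pow 22)).const_mul ((-132) : ℝ))).add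
      (((hA.pow 12).mul (hu.pow 24)).const_mul (11 : ℝ)))
  refine Tendsto.congr' ?_ (tendsto_of_tendsto_of_eq_em h (by norm_num))
  filter_upwards [eventually_gt_atTop (0 : ℝ)] with y hy
  have hw : wallRate y ≠ 0 := (wallRate_pos y).ne'
  have hy' : y ≠ 0 := hy.ne'
  field_simp
  ring

/-- ★★★ **`y⁸ (m(y) − 1 − 2/y² − 3/y³ − 11/y⁴ − 30/y⁵ − 73/y⁶ − 211/y⁷) → 513`**, i.e.
**`m(y) = 1 + 2/y² + 3/y³ + 11/y⁴ + 30/y⁵ + 73/y⁶ + 211/y⁷ + 513/y⁸ + o(y⁻⁸)`** (`y → ∞`): `513 = 0 + 4 + 12 + 60 − 135 − 756 − 616 + 712 + 891 + 330 + 11`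
(the vanishing remainder of §2 and the ten term-wise eighth-order corrections).  Only the sixth-order two-sided window of `β²` enters (through `K`).
[cite: MadrasSlade1993, Section 4.2, (4.2.5) and Theorem 4.2.2 (pp. 91–92)] [cite: Kesten1963SAW, Section 4] [cite: EntingJensen2009, Section 7.4.2, Fig. 7.10] -/
theorem tendsto_pow_eight_mul_pwbMean_sub_seven_terms :
    Tendsto (fun y : ℝ => y ^ 8 * (pwbMean y - 1 - 2 / y ^ 2 - 3 / y ^ 3 - 11 / y ^ 4 - 30 / y ^ 5 - 73 / y ^ 6 - 211 / y ^ 7)) atTop (𝓝 513) := by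
  have h := (((((((((tendsto_pow_eight_mul_pwbMean_sub.add tendsto_pow_eight_mul_two_mul_div_sub).add
    tendsto_pow_eight_mul_three_mul_div_sub).add tendsto_pow_eight_mul_twelve_mul_div_sub).add tendsto_pow_eight_mul_twelves_sub).add
    tendsto_pow_eight_mul_fourteens_sub).add tendsto_pow_eight_mul_sixteens_sub).add tendsto_pow_eight_mul_eighteens_sub).add
    tendsto_pow_eight_mul_twenties_sub).add tendsto_pow_eight_mul_twentytwos_sub).add tendsto_pow_eight_mul_hook_four_sub
  refine Tendsto.congr' ?_ (tendsto_of_tendsto_of_eq_em h (by norm_num))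
  filter_upwards [eventually_gt_atTop (0 : ℝ)] with y hy
  have hy' : y ≠ 0 := hy.ne'
  have hw : wallRate y ≠ 0 := (wallRate_pos y).ne'
  field_simp
  ring

/-- ★ **Asymptotic equivalence** `m(y) − 1 − 2/y² − 3/y³ − 11/y⁴ − 30/y⁵ − 73/y⁶ − 211/y⁷ ∼ 513/y⁸` (`y → ∞`).
[cite: MadrasSlade1993, Section 4.2, Theorem 4.2.2 (pp. 91–92)] [cite: Kesten1963SAW, Section 4] -/
theorem isEquivalent_pwbMean_sub_seven_terms :
    (fun y : ℝ => pwbMean y - 1 - 2 / y ^ 2 - 3 / y ^ 3 - 11 / y ^ 4 - 30 / y ^ 5 - 73 / y ^ 6 - 211 / y ^ 7) ~[atTop] fun y : ℝ => 513 / y ^ 8 := by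
  have hz : ∀ᶠ y : ℝ in atTop, (513 : ℝ) / y ^ 8 ≠ 0 := by
    filter_upwards [eventually_gt_atTop (0 : ℝ)] with y hy
    positivity
  refine (isEquivalent_iff_tendsto_one hz).2 ?_
  have h := tendsto_pow_eight_mul_pwbMean_sub_seven_terms.div_const 513
  rw [show ((513 : ℝ) / 513) = 1 by norm_num] at h
  refine h.congr' ?_
  filter_upwards [eventually_gt_atTop (0 : ℝ)] with y hy
  simp only [Pi.div_apply]
  rw [div_div_eq_mul_div]
  ring

/-! ## Part II — the visit mean and the contact density to EIGHTH order

### §4  Visit-excess laws at order eight: the classes `(11,3)` and `(12,4)` two-sided, the envelope from length twenty-six on, the series beyond half-length twelve -/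

open Classical in
/-- ★ **Class lower bound for the visit excess**: `(V − 1)·N_{n,V}·y^V ≤ Λ^v_n(y) − Λ_n(y)` for `y ≥ 0` (every block contributes `(visits − 1)y^{visits} ≥ 0`).
[cite: MadrasSlade1993, Section 4.2, (4.2.2) (p. 91)] [cite: Kesten1963SAW, Section 4] -/
theorem class_mul_pow_le_IPWBV_sub_IPWB (n V : ℕ) (hy : 0 ≤ y) :
    ((V : ℝ) - 1) * #((ipwb n).filter fun ω => visits n ω = V) * y ^ V ≤ IPWBV n y - IPWB n y := by
  rw [IPWBV_sub_IPWB_eq_sum, ← Finset.sum_filter_add_sum_filter_not (ipwb n) (fun ω => visits n ω = V)]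
  have h1 : ∑ ω ∈ (ipwb n).filter (fun ω => visits n ω = V), ((visits n ω : ℝ) - 1) * y ^ visits n ω =
      ((V : ℝ) - 1) * #((ipwb n).filter fun ω => visits n ω = V) * y ^ V := by
    rw [Finset.sum_congr rfl fun ω hω => by rw [(Finset.mem_filter.1 hω).2], Finset.sum_const, nsmul_eq_mul]
    ring
  have h2 : 0 ≤ ∑ ω ∈ (ipwb n).filter (fun ω => ¬ visits n ω = V), ((visits n ω : ℝ) - 1) * y ^ visits n ω :=
    Finset.sum_nonneg fun ω hω => by
      have h1 := one_le_visits_of_mem_ipwb (Finset.mem_filter.1 hω).1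
      have : (1 : ℝ) ≤ visits n ω := by exact_mod_cast h1
      exact mul_nonneg (by linarith) (pow_nonneg hy _)
  rw [h1]
  linarith

open Classical in
/-- ★ **The visit excess at length twenty-two**: `66y³ ≤ Λ^v₂₂(y) − Λ₂₂(y) ≤ 3²²y² + 66y³` (`y ≥ 1`; the thirty-three three-visit blocks «CENSUS-EIGHT-B2» contribute
`2·33·y³`, the one- and two-visit ones at most `y²` each). [cite: MadrasSlade1993, Section 1.2, (1.2.3); Section 4.2, (4.2.2) (p. 91)] [cite: Kesten1963SAW, Section 4] -/
theorem IPWBV_sub_IPWB_twentytwo_two_sided {m : ℕ} (hm : m = 22) (hy : 1 ≤ y) :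
    66 * y ^ 3 ≤ IPWBV m y - IPWB m y ∧ IPWBV m y - IPWB m y ≤ 3 ^ m * y ^ 2 + 66 * y ^ 3 := by
  have hy0 : 0 ≤ y := by linarith
  have hlo := class_mul_pow_le_IPWBV_sub_IPWB m 3 hy0
  rw [card_threeVisit_ipwb_twentytwo_eq_thirtyThree hm] at hlo
  push_cast at hlo
  refine ⟨by linarith, ?_⟩
  rw [IPWBV_sub_IPWB_eq_sum, ← Finset.sum_filter_add_sum_filter_not (ipwb m) (fun ω => visits m ω = 3)]
  have h1 : ∑ ω ∈ (ipwb m).filter (fun ω => visits m ω = 3), ((visits m ω : ℝ) - 1) * y ^ visits m ω = 66 * y ^ 3 := by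
    rw [Finset.sum_congr rfl fun ω hω => by rw [(Finset.mem_filter.1 hω).2], Finset.sum_const, nsmul_eq_mul,
      card_threeVisit_ipwb_twentytwo_eq_thirtyThree hm]
    push_cast
    ring
  have h2 : ∑ ω ∈ (ipwb m).filter (fun ω => ¬ visits m ω = 3), ((visits m ω : ℝ) - 1) * y ^ visits m ω ≤ 3 ^ m * y ^ 2 := by
    have h := Finset.sum_le_card_nsmul ((ipwb m).filter fun ω => ¬ visits m ω = 3) (fun ω => ((visits m ω : ℝ) - 1) * y ^ visits m ω)
      (y ^ 2) fun ω hω => by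
      have hne : ¬ visits m ω = 3 := (Finset.mem_filter.1 hω).2
      have hω : ω ∈ ipwb m := (Finset.mem_filter.1 hω).1
      have h1 := one_le_visits_of_mem_ipwb hω
      have h3 : visits m ω ≤ m / 2 - 8 := visits_le_half_sub_eight (n := m) (by omega) hω
      have hv : visits m ω = 1 ∨ visits m ω = 2 := by omega
      rcases hv with hv | hv
      · rw [hv]; push_cast; nlinarith
      · rw [hv]; push_cast; nlinarith
    rw [nsmul_eq_mul] at h
    have hc : (#((ipwb m).filter fun ω => ¬ visits m ω = 3) : ℝ) ≤ 3 ^ m :=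
      le_trans (by exact_mod_cast Finset.card_le_card (Finset.filter_subset _ _)) (card_ipwb_le_three_pow m)
    calc _ ≤ (#((ipwb m).filter fun ω => ¬ visits m ω = 3) : ℝ) * y ^ 2 := h
      _ ≤ 3 ^ m * y ^ 2 := by gcongr
  rw [h1]
  linarith

open Classical in
/-- ★ **The visit excess at length twenty-four**: `3y⁴ ≤ Λ^v₂₄(y) − Λ₂₄(y) ≤ 2·3²⁴y³ + 3y⁴` (`y ≥ 1`; the hook `H₄` («SIX-STEP-RIGIDITY») contributes `3y⁴`,
the blocks with at most three visits at most `2y³` each). [cite: MadrasSlade1993, Section 1.2, (1.2.3); Section 4.2, (4.2.2) (p. 91)] [cite: Kesten1963SAW, Section 4] -/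
theorem IPWBV_sub_IPWB_twentyfour_two_sided {m : ℕ} (hm : m = 24) (hy : 1 ≤ y) :
    3 * y ^ 4 ≤ IPWBV m y - IPWB m y ∧ IPWBV m y - IPWB m y ≤ 2 * 3 ^ m * y ^ 3 + 3 * y ^ 4 := by
  have hy0 : 0 ≤ y := by linarith
  have hlo := class_mul_pow_le_IPWBV_sub_IPWB m 4 hy0
  rw [card_fourVisit_ipwb_twentyfour_eq_one hm] at hlo
  push_cast at hlo
  refine ⟨by linarith, ?_⟩
  rw [IPWBV_sub_IPWB_eq_sum, ← Finset.sum_filter_add_sum_filter_not (ipwb m) (fun ω => visits m ω = 4)]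
  have h1 : ∑ ω ∈ (ipwb m).filter (fun ω => visits m ω = 4), ((visits m ω : ℝ) - 1) * y ^ visits m ω = 3 * y ^ 4 := by
    rw [Finset.sum_congr rfl fun ω hω => by rw [(Finset.mem_filter.1 hω).2], Finset.sum_const, nsmul_eq_mul,
      card_fourVisit_ipwb_twentyfour_eq_one hm]
    push_cast
    ring
  have h2 : ∑ ω ∈ (ipwb m).filter (fun ω => ¬ visits m ω = 4), ((visits m ω : ℝ) - 1) * y ^ visits m ω ≤ 2 * 3 ^ m * y ^ 3 := by
    have h := Finset.sum_le_card_nsmul ((ipwb m).filter fun ω => ¬ visits m ω = 4) (fun ω => ((visits m ω : ℝ) - 1) * y ^ visits m ω)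
      (2 * y ^ 3) fun ω hω => by
      have hne : ¬ visits m ω = 4 := (Finset.mem_filter.1 hω).2
      have hω : ω ∈ ipwb m := (Finset.mem_filter.1 hω).1
      have h1 := one_le_visits_of_mem_ipwb hω
      have h3 : visits m ω ≤ m / 2 - 8 := visits_le_half_sub_eight (n := m) (by omega) hω
      have hv : visits m ω = 1 ∨ visits m ω = 2 ∨ visits m ω = 3 := by omega
      have hy2 : y ^ 2 ≤ y ^ 3 := by nlinarith
      rcases hv with hv | hv | hv
      · rw [hv]; push_cast; nlinarith
      · rw [hv]; push_cast; nlinarith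
      · rw [hv]; push_cast; nlinarith
    rw [nsmul_eq_mul] at h
    have hc : (#((ipwb m).filter fun ω => ¬ visits m ω = 4) : ℝ) ≤ 3 ^ m :=
      le_trans (by exact_mod_cast Finset.card_le_card (Finset.filter_subset _ _)) (card_ipwb_le_three_pow m)
    calc _ ≤ (#((ipwb m).filter fun ω => ¬ visits m ω = 4) : ℝ) * (2 * y ^ 3) := h
      _ ≤ 3 ^ m * (2 * y ^ 3) := by gcongr
      _ = 2 * 3 ^ m * y ^ 3 := by ring
  rw [h1]
  linarith

/-- **Envelope of the visit excess from length twenty-six on**: `Λ^v_n(y) − Λ_n(y) ≤ (n/2 − 10)·#(ipwb n)·y^{n/2 − 9}` for `n ≥ 26`, `y ≥ 1`.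
[cite: MadrasSlade1993, Section 4.2, (4.2.2) and remark before (4.2.21) (pp. 91–94)] -/
theorem IPWBV_sub_IPWB_le_of_twentysix_le (hn : 26 ≤ n) (hy : 1 ≤ y) :
    IPWBV n y - IPWB n y ≤ ((n / 2 - 10 : ℕ) : ℝ) * #(ipwb n) * y ^ (n / 2 - 9) := by
  rw [IPWBV_sub_IPWB_eq_sum]
  have h := Finset.sum_le_card_nsmul (ipwb n) (fun ω => ((visits n ω : ℝ) - 1) * y ^ visits n ω)
    (((n / 2 - 10 : ℕ) : ℝ) * y ^ (n / 2 - 9)) fun ω hω => by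
    have h1 := one_le_visits_of_mem_ipwb hω
    have h2 := visits_le_half_sub_nine hn hω
    have hv : ((visits n ω : ℝ) - 1) ≤ ((n / 2 - 10 : ℕ) : ℝ) := by
      have : visits n ω - 1 ≤ n / 2 - 10 := by omega
      have e : ((visits n ω : ℝ) - 1) = ((visits n ω - 1 : ℕ) : ℝ) := by push_cast [h1]; ring
      rw [e]; exact_mod_cast this
    exact mul_le_mul hv (pow_le_pow_right₀ hy h2) (by positivity) (by positivity)
  rw [nsmul_eq_mul] at h
  calc _ ≤ (#(ipwb n) : ℝ) * (((n / 2 - 10 : ℕ) : ℝ) * y ^ (n / 2 - 9)) := h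
    _ = _ := by ring

/-- ★ `(Λ^v − Λ)_{2s}(y)/β(y)^{2s} ≤ (s − 10)·9^s/y⁹` for `13 ≤ s`, `y ≥ 1`. [cite: MadrasSlade1993, Section 1.2, (1.2.3); Section 4.2, (4.2.2) (p. 91)] -/
theorem visitExcess_term_le_nine_pow_nine {s : ℕ} (hs : 13 ≤ s) (hy : 1 ≤ y) :
    (IPWBV (2 * s) y - IPWB (2 * s) y) / wallRate y ^ (2 * s) ≤ ((s : ℝ) - 10) * 9 ^ s / y ^ 9 := by
  have hy0 : 0 < y := by linarith
  have h1 := IPWBV_sub_IPWB_le_of_twentysix_le (n := 2 * s) (by omega) hy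
  rw [show 2 * s / 2 - 10 = s - 10 by omega, show 2 * s / 2 - 9 = s - 9 by omega] at h1
  have hc : (#(ipwb (2 * s)) : ℝ) ≤ 9 ^ s := by
    calc (#(ipwb (2 * s)) : ℝ) ≤ 3 ^ (2 * s) := card_ipwb_le_three_pow _
      _ = 9 ^ s := by rw [pow_mul]; norm_num
  have hs9 : ((s - 10 : ℕ) : ℝ) = (s : ℝ) - 10 := by push_cast [show 10 ≤ s by omega]; ring
  have hs0 : (0 : ℝ) ≤ (s : ℝ) - 10 := by
    have : (10 : ℝ) ≤ s := by exact_mod_cast (show 10 ≤ s by omega)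
    linarith
  have h2 : IPWBV (2 * s) y - IPWB (2 * s) y ≤ ((s : ℝ) - 10) * 9 ^ s * y ^ (s - 9) := by
    rw [hs9] at h1
    calc _ ≤ ((s : ℝ) - 10) * #(ipwb (2 * s)) * y ^ (s - 9) := h1
      _ ≤ ((s : ℝ) - 10) * 9 ^ s * y ^ (s - 9) := by gcongr
  have hden : y ^ s ≤ wallRate y ^ (2 * s) := pow_le_wallRate_pow_em hy0 s
  have hnum0 : 0 ≤ ((s : ℝ) - 10) * 9 ^ s * y ^ (s - 9) := by positivity
  calc (IPWBV (2 * s) y - IPWB (2 * s) y) / wallRate y ^ (2 * s) ≤ ((s : ℝ) - 10) * 9 ^ s * y ^ (s - 9) / wallRate y ^ (2 * s) :=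
        div_le_div_of_nonneg_right h2 (pow_nonneg (wallRate_pos y).le _)
    _ ≤ ((s : ℝ) - 10) * 9 ^ s * y ^ (s - 9) / y ^ s := div_le_div_of_nonneg_left hnum0 (by positivity) hden
    _ = ((s : ℝ) - 10) * 9 ^ s / y ^ 9 := by
        rw [div_eq_div_iff (by positivity) (by positivity)]
        rw [show ((s : ℝ) - 10) * 9 ^ s * y ^ (s - 9) * y ^ 9 = ((s : ℝ) - 10) * 9 ^ s * (y ^ (s - 9) * y ^ 9) by ring, ← pow_add,
          show s - 9 + 9 = s by omega]

/-- **The visit-excess series beyond half-length twelve** (`y > μ⁴`): `Σ_{j ≥ 0} (Λ^v − Λ)_{2(j+13)}/β^{2(j+13)} =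
V − 1 − y²/β¹² − 3y²/β¹⁴ − 11y²/β¹⁶ − (34y² + 2y³)/β¹⁸ − (99y² + 14y³)/β²⁰ − (Λ^v − Λ)₂₂/β²² − (Λ^v − Λ)₂₄/β²⁴` («CENSUS-EIGHT-A»: `N₁₀,₂ = 99`).
[cite: MadrasSlade1993, Section 4.2, (4.2.4)–(4.2.5) and Theorem 4.2.2 (pp. 91–92)] [cite: Kesten1963SAW, Section 4] -/
theorem hasSum_visitExcess_twentysix (hy : hexConnectiveConstant ^ 4 < y) :
    HasSum (fun j : ℕ => (IPWBV (2 * (j + 13)) y - IPWB (2 * (j + 13)) y) / wallRate y ^ (2 * (j + 13)))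
      (pwbVisitMean y - 1 - y ^ 2 / wallRate y ^ 12 - 3 * y ^ 2 / wallRate y ^ 14 - 11 * y ^ 2 / wallRate y ^ 16 -
        (34 * y ^ 2 + 2 * y ^ 3) / wallRate y ^ 18 - (99 * y ^ 2 + 14 * y ^ 3) / wallRate y ^ 20 -
        (IPWBV 22 y - IPWB 22 y) / wallRate y ^ 22 - (IPWBV 24 y - IPWB 24 y) / wallRate y ^ 24) := by
  classical
  obtain ⟨m, hm⟩ : ∃ m : ℕ, m = 20 := ⟨_, rfl⟩
  have h := (hasSum_nat_add_iff' 2).2 (hasSum_visitExcess_twentytwo hy hm)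
  rw [card_twoVisit_ipwb_twenty_eq_ninetyNine hm] at h
  have hsum : ∑ i ∈ Finset.range 2, (IPWBV (2 * (i + 11)) y - IPWB (2 * (i + 11)) y) / wallRate y ^ (2 * (i + 11)) =
      (IPWBV 22 y - IPWB 22 y) / wallRate y ^ 22 + (IPWBV 24 y - IPWB 24 y) / wallRate y ^ 24 := by
    rw [Finset.sum_range_succ, Finset.sum_range_succ, Finset.sum_range_zero, zero_add]
  rw [hsum] at h
  have e : pwbVisitMean y - 1 - y ^ 2 / wallRate y ^ 12 - 3 * y ^ 2 / wallRate y ^ 14 - 11 * y ^ 2 / wallRate y ^ 16 -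
        (34 * y ^ 2 + 2 * y ^ 3) / wallRate y ^ 18 - (99 * y ^ 2 + 14 * y ^ 3) / wallRate y ^ 20 -
        (IPWBV 22 y - IPWB 22 y) / wallRate y ^ 22 - (IPWBV 24 y - IPWB 24 y) / wallRate y ^ 24 =
      pwbVisitMean y - 1 - y ^ 2 / wallRate y ^ 12 - 3 * y ^ 2 / wallRate y ^ 14 - 11 * y ^ 2 / wallRate y ^ 16 -
        (34 * y ^ 2 + 2 * y ^ 3) / wallRate y ^ 18 - ((99 : ℕ) * y ^ 2 + 14 * y ^ 3) / wallRate y ^ 20 -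
        ((IPWBV 22 y - IPWB 22 y) / wallRate y ^ 22 + (IPWBV 24 y - IPWB 24 y) / wallRate y ^ 24) := by
    push_cast; ring
  rw [e]
  refine h.congr_fun fun j => ?_
  rw [show j + 2 + 11 = j + 13 by omega]

/-- ★★ **Lower bound** (`y > μ⁴`): `y²/β¹² + 3y²/β¹⁴ + 11y²/β¹⁶ + (34y² + 2y³)/β¹⁸ + (99y² + 14y³)/β²⁰ + 66y³/β²² + 3y⁴/β²⁴ ≤ V(y) − 1`.
[cite: MadrasSlade1993, Section 4.2, (4.2.4)–(4.2.5) (p. 91)] [cite: Kesten1963SAW, Section 4] -/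
theorem pwbVisitMean_sub_one_ge_eight (hy : hexConnectiveConstant ^ 4 < y) :
    y ^ 2 / wallRate y ^ 12 + 3 * y ^ 2 / wallRate y ^ 14 + 11 * y ^ 2 / wallRate y ^ 16 + (34 * y ^ 2 + 2 * y ^ 3) / wallRate y ^ 18 +
        (99 * y ^ 2 + 14 * y ^ 3) / wallRate y ^ 20 + 66 * y ^ 3 / wallRate y ^ 22 + 3 * y ^ 4 / wallRate y ^ 24 ≤ pwbVisitMean y - 1 := by
  obtain ⟨m, hm⟩ : ∃ m : ℕ, m = 22 := ⟨_, rfl⟩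
  obtain ⟨m', hm'⟩ : ∃ m' : ℕ, m' = 24 := ⟨_, rfl⟩
  have hy1 : 1 ≤ y := le_trans (by have := four_le_mu_four_em; linarith) hy.le
  have hy0 : 0 ≤ y := by linarith
  have h := (hasSum_visitExcess_twentysix hy).nonneg fun j =>
    div_nonneg (sub_nonneg.2 (IPWB_le_IPWBV _ hy0)) (pow_nonneg (wallRate_pos y).le _)
  have h22 := (IPWBV_sub_IPWB_twentytwo_two_sided hm hy1).1
  have h24 := (IPWBV_sub_IPWB_twentyfour_two_sided hm' hy1).1
  rw [hm] at h22
  rw [hm'] at h24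
  have hβ22 : 0 < wallRate y ^ 22 := pow_pos (wallRate_pos y) 22
  have hβ24 : 0 < wallRate y ^ 24 := pow_pos (wallRate_pos y) 24
  have d22 : 66 * y ^ 3 / wallRate y ^ 22 ≤ (IPWBV 22 y - IPWB 22 y) / wallRate y ^ 22 := div_le_div_of_nonneg_right h22 hβ22.le
  have d24 : 3 * y ^ 4 / wallRate y ^ 24 ≤ (IPWBV 24 y - IPWB 24 y) / wallRate y ^ 24 := div_le_div_of_nonneg_right h24 hβ24.le
  linarith

/-- ★★ **Upper bound** (`y ≥ 48`): `V(y) − 1 ≤ y²/β¹² + 3y²/β¹⁴ + 11y²/β¹⁶ + (34y² + 2y³)/β¹⁸ + (99y² + 14y³)/β²⁰ + 66y³/β²² + 3y⁴/β²⁴ +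
128987577698687676/y⁹ + 18 μ³⁸/(y⁸√y)` (the `≤ 2`-visit twenty-twos, the `≤ 3`-visit twenty-fours and `s = 13 … 17` crude; half of the mean's tail beyond seventeen).
[cite: MadrasSlade1993, Section 4.2, (4.2.4)–(4.2.5), Theorem 4.2.2 and remark before (4.2.21) (pp. 91–94)] [cite: Kesten1963SAW, Section 4] -/
theorem pwbVisitMean_sub_one_le_eight (hy : 48 ≤ y) :
    pwbVisitMean y - 1 ≤ y ^ 2 / wallRate y ^ 12 + 3 * y ^ 2 / wallRate y ^ 14 + 11 * y ^ 2 / wallRate y ^ 16 +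
      (34 * y ^ 2 + 2 * y ^ 3) / wallRate y ^ 18 + (99 * y ^ 2 + 14 * y ^ 3) / wallRate y ^ 20 + 66 * y ^ 3 / wallRate y ^ 22 + 3 * y ^ 4 / wallRate y ^ 24 +
      128987577698687676 / y ^ 9 + 18 * hexConnectiveConstant ^ 38 / (y ^ 8 * Real.sqrt y) := by
  obtain ⟨m, hm⟩ : ∃ m : ℕ, m = 22 := ⟨_, rfl⟩
  obtain ⟨m', hm'⟩ : ∃ m' : ℕ, m' = 24 := ⟨_, rfl⟩
  have hy0 : 0 < y := by linarith
  have hy1 : 1 ≤ y := by linarith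
  have hμ : hexConnectiveConstant ^ 4 < y := mu_four_lt_twelve_em.trans_le (by linarith)
  have h := (hasSum_nat_add_iff' 5).2 (hasSum_visitExcess_twentysix hμ)
  have hT := hasSum_excess_tail_eighteen hμ
  have hTle := excess_tail_eighteen_le hy
  have hle : ∀ j : ℕ, (IPWBV (2 * (j + 5 + 13)) y - IPWB (2 * (j + 5 + 13)) y) / wallRate y ^ (2 * (j + 5 + 13)) ≤
      1 / 2 * (((j : ℝ) + 17) * pwbLaw y (j + 18)) := by
    intro j
    have h1 := IPWBV_sub_IPWB_le_mul (j + 5 + 13) hy0.le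
    have hβ : 0 < wallRate y ^ (2 * (j + 5 + 13)) := pow_pos (wallRate_pos y) _
    rw [pwbLaw, show j + 18 = j + 5 + 13 by omega]
    calc (IPWBV (2 * (j + 5 + 13)) y - IPWB (2 * (j + 5 + 13)) y) / wallRate y ^ (2 * (j + 5 + 13))
        ≤ (((j + 5 + 13 : ℕ) : ℝ) - 1) / 2 * IPWB (2 * (j + 5 + 13)) y / wallRate y ^ (2 * (j + 5 + 13)) :=
          div_le_div_of_nonneg_right h1 hβ.le
      _ = 1 / 2 * (((j : ℝ) + 17) * (IPWB (2 * (j + 5 + 13)) y / wallRate y ^ (2 * (j + 5 + 13)))) := by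
          push_cast; ring
  have hsum := hasSum_le hle h (hT.mul_left (1 / 2))
  -- the five census-unknown terms `s = 13 … 17`
  have h13 := visitExcess_term_le_nine_pow_nine (s := 13) (by norm_num) hy1
  have h14 := visitExcess_term_le_nine_pow_nine (s := 14) (by norm_num) hy1
  have h15 := visitExcess_term_le_nine_pow_nine (s := 15) (by norm_num) hy1
  have h16 := visitExcess_term_le_nine_pow_nine (s := 16) (by norm_num) hy1
  have h17 := visitExcess_term_le_nine_pow_nine (s := 17) (by norm_num) hy1
  have hfive : ∑ i ∈ Finset.range 5, (IPWBV (2 * (i + 13)) y - IPWB (2 * (i + 13)) y) / wallRate y ^ (2 * (i + 13)) ≤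
      128986981458555105 / y ^ 9 := by
    rw [Finset.sum_range_succ, Finset.sum_range_succ, Finset.sum_range_succ, Finset.sum_range_succ, Finset.sum_range_succ,
      Finset.sum_range_zero, zero_add,
      show 2 * (0 + 13) = 2 * 13 by norm_num, show 2 * (1 + 13) = 2 * 14 by norm_num, show 2 * (2 + 13) = 2 * 15 by norm_num,
      show 2 * (3 + 13) = 2 * 16 by norm_num, show 2 * (4 + 13) = 2 * 17 by norm_num]
    have e : (128986981458555105 : ℝ) / y ^ 9 = ((13 : ℕ) - 10 : ℝ) * 9 ^ 13 / y ^ 9 + ((14 : ℕ) - 10 : ℝ) * 9 ^ 14 / y ^ 9 +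
        ((15 : ℕ) - 10 : ℝ) * 9 ^ 15 / y ^ 9 + ((16 : ℕ) - 10 : ℝ) * 9 ^ 16 / y ^ 9 + ((17 : ℕ) - 10 : ℝ) * 9 ^ 17 / y ^ 9 := by
      push_cast
      field_simp
      norm_num
    rw [e]
    linarith
  -- the `≤ 2`-visit twenty-twos and the `≤ 3`-visit twenty-fours
  have h22 := (IPWBV_sub_IPWB_twentytwo_two_sided hm hy1).2
  have h24 := (IPWBV_sub_IPWB_twentyfour_two_sided hm' hy1).2
  rw [hm] at h22
  rw [hm'] at h24
  have hβ22 : 0 < wallRate y ^ 22 := pow_pos (wallRate_pos y) 22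
  have hβ24 : 0 < wallRate y ^ 24 := pow_pos (wallRate_pos y) 24
  have hden22 : y ^ 11 ≤ wallRate y ^ 22 := pow_le_wallRate_pow_em hy0 11
  have hden24 : y ^ 12 ≤ wallRate y ^ 24 := pow_le_wallRate_pow_em hy0 12
  have d22 : (IPWBV 22 y - IPWB 22 y) / wallRate y ^ 22 ≤ 31381059609 / y ^ 9 + 66 * y ^ 3 / wallRate y ^ 22 := by
    have h1 : (IPWBV 22 y - IPWB 22 y) / wallRate y ^ 22 ≤ ((3 : ℝ) ^ 22 * y ^ 2 + 66 * y ^ 3) / wallRate y ^ 22 :=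
      div_le_div_of_nonneg_right h22 hβ22.le
    have h2 : (3 : ℝ) ^ 22 * y ^ 2 / wallRate y ^ 22 ≤ 3 ^ 22 * y ^ 2 / y ^ 11 := div_le_div_of_nonneg_left (by positivity) (by positivity) hden22
    have e2 : (3 : ℝ) ^ 22 * y ^ 2 / y ^ 11 = 31381059609 / y ^ 9 := by
      rw [div_eq_div_iff (by positivity) (by positivity)]; norm_num; ring
    rw [add_div] at h1
    rw [e2] at h2
    linarith
  have d24 : (IPWBV 24 y - IPWB 24 y) / wallRate y ^ 24 ≤ 564859072962 / y ^ 9 + 3 * y ^ 4 / wallRate y ^ 24 := by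
    have h1 : (IPWBV 24 y - IPWB 24 y) / wallRate y ^ 24 ≤ (2 * (3 : ℝ) ^ 24 * y ^ 3 + 3 * y ^ 4) / wallRate y ^ 24 :=
      div_le_div_of_nonneg_right h24 hβ24.le
    have h2 : 2 * (3 : ℝ) ^ 24 * y ^ 3 / wallRate y ^ 24 ≤ 2 * 3 ^ 24 * y ^ 3 / y ^ 12 :=
      div_le_div_of_nonneg_left (by positivity) (by positivity) hden24
    have e2 : 2 * (3 : ℝ) ^ 24 * y ^ 3 / y ^ 12 = 564859072962 / y ^ 9 := by
      rw [div_eq_div_iff (by positivity) (by positivity)]; norm_num; ring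
    rw [add_div] at h1
    rw [e2] at h2
    linarith
  have hhalf : 1 / 2 * (pwbMean y - 1 - (2 * pwbLaw y 3 + 3 * pwbLaw y 4 + 4 * pwbLaw y 5 + 5 * pwbLaw y 6 + 6 * pwbLaw y 7 +
      7 * pwbLaw y 8 + 8 * pwbLaw y 9 + 9 * pwbLaw y 10 + 10 * pwbLaw y 11 + 11 * pwbLaw y 12 + 12 * pwbLaw y 13 + 13 * pwbLaw y 14 +
      14 * pwbLaw y 15 + 15 * pwbLaw y 16 + 16 * pwbLaw y 17)) ≤ 18 * hexConnectiveConstant ^ 38 / (y ^ 8 * Real.sqrt y) := by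
    have e : 18 * hexConnectiveConstant ^ 38 / (y ^ 8 * Real.sqrt y) = 1 / 2 * (36 * hexConnectiveConstant ^ 38 / (y ^ 8 * Real.sqrt y)) := by
      ring
    rw [e]
    exact mul_le_mul_of_nonneg_left hTle (by norm_num)
  have eC : (128987577698687676 : ℝ) / y ^ 9 = 128986981458555105 / y ^ 9 + 31381059609 / y ^ 9 + 564859072962 / y ^ 9 := by
    rw [← add_div, ← add_div]; norm_num
  rw [eC]
  linarith

/-! ### §5  THE VISIT MEAN TO EIGHTH ORDER: the remainder vanishes and `V = 1 + 1/y⁴ + 3/y⁵ + 7/y⁶ + 21/y⁷ + 50/y⁸ + o(y⁻⁸)` -/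

/-- ★★★ **`y⁸ (V(y) − 1 − y²/β¹² − 3y²/β¹⁴ − 11y²/β¹⁶ − (34y² + 2y³)/β¹⁸ − (99y² + 14y³)/β²⁰ − 66y³/β²² − 3y⁴/β²⁴) → 0`** (`y → ∞`): with the whole
diagonal `s − v ≤ 8` of the visit-weighted census subtracted, nothing of order `y⁻⁸` remains.
[cite: MadrasSlade1993, Section 4.2, Theorem 4.2.2 (pp. 91–92)] [cite: Kesten1963SAW, Section 4] -/
theorem tendsto_pow_eight_mul_pwbVisitMean_sub :
    Tendsto (fun y : ℝ => y ^ 8 * (pwbVisitMean y - 1 - y ^ 2 / wallRate y ^ 12 - 3 * y ^ 2 / wallRate y ^ 14 -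
      11 * y ^ 2 / wallRate y ^ 16 - (34 * y ^ 2 + 2 * y ^ 3) / wallRate y ^ 18 - (99 * y ^ 2 + 14 * y ^ 3) / wallRate y ^ 20 -
      66 * y ^ 3 / wallRate y ^ 22 - 3 * y ^ 4 / wallRate y ^ 24)) atTop (𝓝 0) := by
  have h1 : Tendsto (fun y : ℝ => (128987577698687676 : ℝ) / y) atTop (𝓝 0) := tendsto_const_nhds.div_atTop tendsto_id
  have h2 : Tendsto (fun y : ℝ => 18 * hexConnectiveConstant ^ 38 / Real.sqrt y) atTop (𝓝 0) :=
    tendsto_const_nhds.div_atTop Real.tendsto_sqrt_atTop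
  have hup : Tendsto (fun y : ℝ => 128987577698687676 / y + 18 * hexConnectiveConstant ^ 38 / Real.sqrt y) atTop (𝓝 0) := by
    simpa using h1.add h2
  refine tendsto_of_tendsto_of_tendsto_of_le_of_le' tendsto_const_nhds hup ?_ ?_
  · filter_upwards [eventually_gt_atTop (hexConnectiveConstant ^ 4)] with y hy
    have hy0 : 0 < y := lt_of_le_of_lt (by positivity) hy
    have h := pwbVisitMean_sub_one_ge_eight hy
    exact mul_nonneg (pow_pos hy0 8).le (by linarith)
  · filter_upwards [eventually_ge_atTop (48 : ℝ)] with y hy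
    have hy0 : 0 < y := by linarith
    have h := pwbVisitMean_sub_one_le_eight hy
    have hle : pwbVisitMean y - 1 - y ^ 2 / wallRate y ^ 12 - 3 * y ^ 2 / wallRate y ^ 14 -
        11 * y ^ 2 / wallRate y ^ 16 - (34 * y ^ 2 + 2 * y ^ 3) / wallRate y ^ 18 - (99 * y ^ 2 + 14 * y ^ 3) / wallRate y ^ 20 -
        66 * y ^ 3 / wallRate y ^ 22 - 3 * y ^ 4 / wallRate y ^ 24 ≤
        128987577698687676 / y ^ 9 + 18 * hexConnectiveConstant ^ 38 / (y ^ 8 * Real.sqrt y) := by linarith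
    have hm := mul_le_mul_of_nonneg_left hle (pow_pos hy0 8).le
    have e2 : y ^ 8 * (128987577698687676 / y ^ 9) = 128987577698687676 / y := by
      rw [mul_div_assoc', div_eq_div_iff (by positivity) (by positivity)]; ring
    have e3 : y ^ 8 * (18 * hexConnectiveConstant ^ 38 / (y ^ 8 * Real.sqrt y)) = 18 * hexConnectiveConstant ^ 38 / Real.sqrt y := by
      have hs : 0 < Real.sqrt y := Real.sqrt_pos.2 hy0
      rw [mul_div_assoc', div_eq_div_iff (by positivity) (by positivity)]; ring
    calc _ ≤ y ^ 8 * (128987577698687676 / y ^ 9 + 18 * hexConnectiveConstant ^ 38 / (y ^ 8 * Real.sqrt y)) := hm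
      _ = 128987577698687676 / y + 18 * hexConnectiveConstant ^ 38 / Real.sqrt y := by rw [mul_add, e2, e3]


/-- **The hooked twelve's visit term to eighth order**: `y⁸·(y²/β¹²) − y⁴ + 6y² + 6y → 9`.
[cite: BeatonBousquetMelouDeGierDuminilCopinGuttmann2014, Section 3.1, Proposition 5 (arXiv v5 p. 9)] [cite: MadrasSlade1993, Section 4.2, (4.2.2) (p. 91)] -/
theorem tendsto_pow_eight_mul_sq_div_sub :
    Tendsto (fun y : ℝ => y ^ 8 * (y ^ 2 / wallRate y ^ 12) - y ^ 4 + 6 * y ^ 2 + 6 * y) atTop (𝓝 9) := by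
  have hA := tendsto_sq_mul_one_sub_div_wallRate_sq
  have hP := tendsto_pow_four_mul_one_sub_div_sub
  have hu : Tendsto (fun y : ℝ => y⁻¹) atTop (𝓝 0) := tendsto_inv_atTop_zero
  have h := (((((((hA.pow 2).const_mul (15 : ℝ)).add
      (hP.const_mul ((-6) : ℝ))).add
      (((hA.pow 3).mul (hu.pow 2)).const_mul ((-20) : ℝ))).add
      (((hA.pow 4).mul (hu.pow 4)).const_mul (15 : ℝ))).add
      (((hA.pow 5).mul (hu.pow 6)).const_mul ((-6) : ℝ))).add
      ((hA.pow 6).mul (hu.pow 8)))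
  refine Tendsto.congr' ?_ (tendsto_of_tendsto_of_eq_em h (by norm_num))
  filter_upwards [eventually_gt_atTop (0 : ℝ)] with y hy
  have hw : wallRate y ≠ 0 := (wallRate_pos y).ne'
  have hy' : y ≠ 0 := hy.ne'
  field_simp
  ring

/-- **The hooked fourteens' visit term to eighth order**: `y⁸·(3y²/β¹⁴) − 3y³ + 21y → −21`.
[cite: BeatonBousquetMelouDeGierDuminilCopinGuttmann2014, Section 3.1, Proposition 5 (arXiv v5 p. 9)] [cite: MadrasSlade1993, Section 4.2, (4.2.2) (p. 91)] -/
theorem tendsto_pow_eight_mul_three_sq_div_sub :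
    Tendsto (fun y : ℝ => y ^ 8 * (3 * y ^ 2 / wallRate y ^ 14) - 3 * y ^ 3 + 21 * y) atTop (𝓝 (-21)) := by
  have hA := tendsto_sq_mul_one_sub_div_wallRate_sq
  have hQ := tendsto_cube_mul_one_sub_div_sub
  have hu : Tendsto (fun y : ℝ => y⁻¹) atTop (𝓝 0) := tendsto_inv_atTop_zero
  have h := (((((((hQ.const_mul ((-21) : ℝ)).add
      (((hA.pow 2).mul hu).const_mul (63 : ℝ))).add
      (((hA.pow 3).mul (hu.pow 3)).const_mul ((-105) : ℝ))).add
      (((hA.pow 4).mul (hu.pow 5)).const_mul (105 : ℝ))).add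
      (((hA.pow 5).mul (hu.pow 7)).const_mul ((-63) : ℝ))).add
      (((hA.pow 6).mul (hu.pow 9)).const_mul (21 : ℝ))).add
      (((hA.pow 7).mul (hu.pow 11)).const_mul ((-3) : ℝ)))
  refine Tendsto.congr' ?_ (tendsto_of_tendsto_of_eq_em h (by norm_num))
  filter_upwards [eventually_gt_atTop (0 : ℝ)] with y hy
  have hw : wallRate y ≠ 0 := (wallRate_pos y).ne'
  have hy' : y ≠ 0 := hy.ne'
  field_simp
  ring

/-- **The two-visit sixteens' visit term to eighth order**: `y⁸·(11y²/β¹⁶) − 11y² → −88`.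
[cite: BeatonBousquetMelouDeGierDuminilCopinGuttmann2014, Section 3.1, Proposition 5 (arXiv v5 p. 9)] [cite: MadrasSlade1993, Section 4.2, (4.2.2) (p. 91)] -/
theorem tendsto_pow_eight_mul_eleven_sq_div_sub :
    Tendsto (fun y : ℝ => y ^ 8 * (11 * y ^ 2 / wallRate y ^ 16) - 11 * y ^ 2) atTop (𝓝 (-88)) := by
  have hA := tendsto_sq_mul_one_sub_div_wallRate_sq
  have hu : Tendsto (fun y : ℝ => y⁻¹) atTop (𝓝 0) := tendsto_inv_atTop_zero
  have h := ((((((((hA.const_mul ((-88) : ℝ)).add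
      (((hA.pow 2).mul (hu.pow 2)).const_mul (308 : ℝ))).add
      (((hA.pow 3).mul (hu.pow 4)).const_mul ((-616) : ℝ))).add
      (((hA.pow 4).mul (hu.pow 6)).const_mul (770 : ℝ))).add
      (((hA.pow 5).mul (hu.pow 8)).const_mul ((-616) : ℝ))).add
      (((hA.pow 6).mul (hu.pow 10)).const_mul (308 : ℝ))).add
      (((hA.pow 7).mul (hu.pow 12)).const_mul ((-88) : ℝ))).add
      (((hA.pow 8).mul (hu.pow 14)).const_mul (11 : ℝ)))
  refine Tendsto.congr' ?_ (tendsto_of_tendsto_of_eq_em h (by norm_num))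
  filter_upwards [eventually_gt_atTop (0 : ℝ)] with y hy
  have hw : wallRate y ≠ 0 := (wallRate_pos y).ne'
  have hy' : y ≠ 0 := hy.ne'
  field_simp
  ring

/-- **The eighteens' visit terms to eighth order**: `y⁸·((34y² + 2y³)/β¹⁸) − 2y² − 34y → −18`.
[cite: BeatonBousquetMelouDeGierDuminilCopinGuttmann2014, Section 3.1, Proposition 5 (arXiv v5 p. 9)] [cite: MadrasSlade1993, Section 4.2, (4.2.2) (p. 91)] -/
theorem tendsto_pow_eight_mul_eighteens_visit_sub :
    Tendsto (fun y : ℝ => y ^ 8 * ((34 * y ^ 2 + 2 * y ^ 3) / wallRate y ^ 18) - 2 * y ^ 2 - 34 * y) atTop (𝓝 (-18)) := by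
  have hA := tendsto_sq_mul_one_sub_div_wallRate_sq
  have hu : Tendsto (fun y : ℝ => y⁻¹) atTop (𝓝 0) := tendsto_inv_atTop_zero
  have h := ((((((((((((((((((hA.const_mul ((-18) : ℝ)).add
      ((hA.mul hu).const_mul ((-306) : ℝ))).add
      (((hA.pow 2).mul (hu.pow 2)).const_mul (72 : ℝ))).add
      (((hA.pow 2).mul (hu.pow 3)).const_mul (1224 : ℝ))).add
      (((hA.pow 3).mul (hu.pow 4)).const_mul ((-168) : ℝ))).add
      (((hA.pow 3).mul (hu.pow 5)).const_mul ((-2856) : ℝ))).add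
      (((hA.pow 4).mul (hu.pow 6)).const_mul (252 : ℝ))).add
      (((hA.pow 4).mul (hu.pow 7)).const_mul (4284 : ℝ))).add
      (((hA.pow 5).mul (hu.pow 8)).const_mul ((-252) : ℝ))).add
      (((hA.pow 5).mul (hu.pow 9)).const_mul ((-4284) : ℝ))).add
      (((hA.pow 6).mul (hu.pow 10)).const_mul (168 : ℝ))).add
      (((hA.pow 6).mul (hu.pow 11)).const_mul (2856 : ℝ))).add
      (((hA.pow 7).mul (hu.pow 12)).const_mul ((-72) : ℝ))).add
      (((hA.pow 7).mul (hu.pow 13)).const_mul ((-1224) : ℝ))).add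
      (((hA.pow 8).mul (hu.pow 14)).const_mul (18 : ℝ))).add
      (((hA.pow 8).mul (hu.pow 15)).const_mul (306 : ℝ))).add
      (((hA.pow 9).mul (hu.pow 16)).const_mul ((-2) : ℝ))).add
      (((hA.pow 9).mul (hu.pow 17)).const_mul ((-34) : ℝ)))
  refine Tendsto.congr' ?_ (tendsto_of_tendsto_of_eq_em h (by norm_num))
  filter_upwards [eventually_gt_atTop (0 : ℝ)] with y hy
  have hw : wallRate y ≠ 0 := (wallRate_pos y).ne'
  have hy' : y ≠ 0 := hy.ne'
  field_simp
  ring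

/-- **The twenties' visit terms to eighth order**: `y⁸·((99y² + 14y³)/β²⁰) − 14y → 99`.
[cite: BeatonBousquetMelouDeGierDuminilCopinGuttmann2014, Section 3.1, Proposition 5 (arXiv v5 p. 9)] [cite: MadrasSlade1993, Section 4.2, (4.2.2) (p. 91)] -/
theorem tendsto_pow_eight_mul_twenties_visit_sub :
    Tendsto (fun y : ℝ => y ^ 8 * ((99 * y ^ 2 + 14 * y ^ 3) / wallRate y ^ 20) - 14 * y) atTop (𝓝 99) := by
  have hA := tendsto_sq_mul_one_sub_div_wallRate_sq
  have hu : Tendsto (fun y : ℝ => y⁻¹) atTop (𝓝 0) := tendsto_inv_atTop_zero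
  have h := (((((((((((((((((((((tendsto_const_nhds (x := (99 : ℝ))).add
      ((hA.mul hu).const_mul ((-140) : ℝ))).add
      ((hA.mul (hu.pow 2)).const_mul ((-990) : ℝ))).add
      (((hA.pow 2).mul (hu.pow 3)).const_mul (630 : ℝ))).add
      (((hA.pow 2).mul (hu.pow 4)).const_mul (4455 : ℝ))).add
      (((hA.pow 3).mul (hu.pow 5)).const_mul ((-1680) : ℝ))).add
      (((hA.pow 3).mul (hu.pow 6)).const_mul ((-11880) : ℝ))).add
      (((hA.pow 4).mul (hu.pow 7)).const_mul (2940 : ℝ))).add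
      (((hA.pow 4).mul (hu.pow 8)).const_mul (20790 : ℝ))).add
      (((hA.pow 5).mul (hu.pow 9)).const_mul ((-3528) : ℝ))).add
      (((hA.pow 5).mul (hu.pow 10)).const_mul ((-24948) : ℝ))).add
      (((hA.pow 6).mul (hu.pow 11)).const_mul (2940 : ℝ))).add
      (((hA.pow 6).mul (hu.pow 12)).const_mul (20790 : ℝ))).add
      (((hA.pow 7).mul (hu.pow 13)).const_mul ((-1680) : ℝ))).add
      (((hA.pow 7).mul (hu.pow 14)).const_mul ((-11880) : ℝ))).add
      (((hA.pow 8).mul (hu.pow 15)).const_mul (630 : ℝ))).add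
      (((hA.pow 8).mul (hu.pow 16)).const_mul (4455 : ℝ))).add
      (((hA.pow 9).mul (hu.pow 17)).const_mul ((-140) : ℝ))).add
      (((hA.pow 9).mul (hu.pow 18)).const_mul ((-990) : ℝ))).add
      (((hA.pow 10).mul (hu.pow 19)).const_mul (14 : ℝ))).add
      (((hA.pow 10).mul (hu.pow 20)).const_mul (99 : ℝ)))
  refine Tendsto.congr' ?_ (tendsto_of_tendsto_of_eq_em h (by norm_num))
  filter_upwards [eventually_gt_atTop (0 : ℝ)] with y hy
  have hw : wallRate y ≠ 0 := (wallRate_pos y).ne'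
  have hy' : y ≠ 0 := hy.ne'
  field_simp
  ring

/-- **The three-visit twenty-twos' visit term to eighth order**: `y⁸·(66y³/β²²) → 66`.
[cite: BeatonBousquetMelouDeGierDuminilCopinGuttmann2014, Section 3.1, Proposition 5 (arXiv v5 p. 9)] [cite: MadrasSlade1993, Section 4.2, (4.2.2) (p. 91)] -/
theorem tendsto_pow_eight_mul_twentytwos_visit_sub :
    Tendsto (fun y : ℝ => y ^ 8 * (66 * y ^ 3 / wallRate y ^ 22) ) atTop (𝓝 66) := by
  have hA := tendsto_sq_mul_one_sub_div_wallRate_sq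
  have hu : Tendsto (fun y : ℝ => y⁻¹) atTop (𝓝 0) := tendsto_inv_atTop_zero
  have h := ((((((((((((tendsto_const_nhds (x := (66 : ℝ))).add
      ((hA.mul (hu.pow 2)).const_mul ((-726) : ℝ))).add
      (((hA.pow 2).mul (hu.pow 4)).const_mul (3630 : ℝ))).add
      (((hA.pow 3).mul (hu.pow 6)).const_mul ((-10890) : ℝ))).add
      (((hA.pow 4).mul (hu.pow 8)).const_mul (21780 : ℝ))).add
      (((hA.pow 5).mul (hu.pow 10)).const_mul ((-30492) : ℝ))).add
      (((hA.pow 6).mul (hu.pow 12)).const_mul (30492 : ℝ))).add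
      (((hA.pow 7).mul (hu.pow 14)).const_mul ((-21780) : ℝ))).add
      (((hA.pow 8).mul (hu.pow 16)).const_mul (10890 : ℝ))).add
      (((hA.pow 9).mul (hu.pow 18)).const_mul ((-3630) : ℝ))).add
      (((hA.pow 10).mul (hu.pow 20)).const_mul (726 : ℝ))).add
      (((hA.pow 11).mul (hu.pow 22)).const_mul ((-66) : ℝ)))
  refine Tendsto.congr' ?_ (tendsto_of_tendsto_of_eq_em h (by norm_num))
  filter_upwards [eventually_gt_atTop (0 : ℝ)] with y hy
  have hw : wallRate y ≠ 0 := (wallRate_pos y).ne'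
  have hy' : y ≠ 0 := hy.ne'
  field_simp
  ring

/-- **The hook `H₄`'s visit term to eighth order**: `y⁸·(3y⁴/β²⁴) → 3`.
[cite: BeatonBousquetMelouDeGierDuminilCopinGuttmann2014, Section 3.1, Proposition 5 (arXiv v5 p. 9)] [cite: MadrasSlade1993, Section 4.2, (4.2.2) (p. 91)] -/
theorem tendsto_pow_eight_mul_hook_four_visit_sub :
    Tendsto (fun y : ℝ => y ^ 8 * (3 * y ^ 4 / wallRate y ^ 24) ) atTop (𝓝 3) := by
  have hA := tendsto_sq_mul_one_sub_div_wallRate_sq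
  have hu : Tendsto (fun y : ℝ => y⁻¹) atTop (𝓝 0) := tendsto_inv_atTop_zero
  have h := (((((((((((((tendsto_const_nhds (x := (3 : ℝ))).add
      ((hA.mul (hu.pow 2)).const_mul ((-36) : ℝ))).add
      (((hA.pow 2).mul (hu.pow 4)).const_mul (198 : ℝ))).add
      (((hA.pow 3).mul (hu.pow 6)).const_mul ((-660) : ℝ))).add
      (((hA.pow 4).mul (hu.pow 8)).const_mul (1485 : ℝ))).add
      (((hA.pow 5).mul (hu.pow 10)).const_mul ((-2376) : ℝ))).add
      (((hA.pow 6).mul (hu.pow 12)).const_mul (2772 : ℝ))).add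
      (((hA.pow 7).mul (hu.pow 14)).const_mul ((-2376) : ℝ))).add
      (((hA.pow 8).mul (hu.pow 16)).const_mul (1485 : ℝ))).add
      (((hA.pow 9).mul (hu.pow 18)).const_mul ((-660) : ℝ))).add
      (((hA.pow 10).mul (hu.pow 20)).const_mul (198 : ℝ))).add
      (((hA.pow 11).mul (hu.pow 22)).const_mul ((-36) : ℝ))).add
      (((hA.pow 12).mul (hu.pow 24)).const_mul (3 : ℝ)))
  refine Tendsto.congr' ?_ (tendsto_of_tendsto_of_eq_em h (by norm_num))
  filter_upwards [eventually_gt_atTop (0 : ℝ)] with y hy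
  have hw : wallRate y ≠ 0 := (wallRate_pos y).ne'
  have hy' : y ≠ 0 := hy.ne'
  field_simp
  ring

/-- ★★★ **`y⁸ (V(y) − 1 − 1/y⁴ − 3/y⁵ − 7/y⁶ − 21/y⁷) → 50`**, i.e. **`V(y) = 1 + 1/y⁴ + 3/y⁵ + 7/y⁶ + 21/y⁷ + 50/y⁸ + o(y⁻⁸)`** (`y → ∞`):
`50 = 0 + 9 − 21 − 88 − 18 + 99 + 66 + 3`. [cite: MadrasSlade1993, Section 4.2, Theorem 4.2.2 (pp. 91–92)] [cite: Kesten1963SAW, Section 4] -/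
theorem tendsto_pow_eight_mul_pwbVisitMean_sub_one_sub :
    Tendsto (fun y : ℝ => y ^ 8 * (pwbVisitMean y - 1 - 1 / y ^ 4 - 3 / y ^ 5 - 7 / y ^ 6 - 21 / y ^ 7)) atTop (𝓝 50) := by
  have h := ((((((tendsto_pow_eight_mul_pwbVisitMean_sub.add tendsto_pow_eight_mul_sq_div_sub).add tendsto_pow_eight_mul_three_sq_div_sub).add
    tendsto_pow_eight_mul_eleven_sq_div_sub).add tendsto_pow_eight_mul_eighteens_visit_sub).add tendsto_pow_eight_mul_twenties_visit_sub).add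
    tendsto_pow_eight_mul_twentytwos_visit_sub).add tendsto_pow_eight_mul_hook_four_visit_sub
  refine Tendsto.congr' ?_ (tendsto_of_tendsto_of_eq_em h (by norm_num))
  filter_upwards [eventually_gt_atTop (0 : ℝ)] with y hy
  have hy' : y ≠ 0 := hy.ne'
  have hw : wallRate y ≠ 0 := (wallRate_pos y).ne'
  field_simp
  ring

/-- ★ `V(y) − 1 − 1/y⁴ − 3/y⁵ − 7/y⁶ − 21/y⁷ ∼ 50/y⁸` (`y → ∞`). [cite: MadrasSlade1993, Section 4.2, Theorem 4.2.2 (pp. 91–92)] -/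
theorem isEquivalent_pwbVisitMean_sub_one_sub_eight :
    (fun y : ℝ => pwbVisitMean y - 1 - 1 / y ^ 4 - 3 / y ^ 5 - 7 / y ^ 6 - 21 / y ^ 7) ~[atTop] fun y : ℝ => 50 / y ^ 8 := by
  have hz : ∀ᶠ y : ℝ in atTop, (50 : ℝ) / y ^ 8 ≠ 0 := by
    filter_upwards [eventually_gt_atTop (0 : ℝ)] with y hy
    positivity
  refine (isEquivalent_iff_tendsto_one hz).2 ?_
  have h := tendsto_pow_eight_mul_pwbVisitMean_sub_one_sub.div_const 50
  rw [show ((50 : ℝ) / 50) = 1 by norm_num] at h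
  refine h.congr' ?_
  filter_upwards [eventually_gt_atTop (0 : ℝ)] with y hy
  simp only [Pi.div_apply]
  rw [div_div_eq_mul_div]
  ring

/-! ### §6  THE CONTACT DENSITY TO EIGHTH ORDER: `½ − ρ(log y) = 1/y² + 3/(2y³) + 3/y⁴ + 15/(2y⁵) + 23/(2y⁶) + 49/(2y⁷) + 35/y⁸ + o(y⁻⁸)` -/

/-- ★★★ **`y⁸ (½ − ρ⁺(log y) − 1/y² − 3/(2y³) − 3/y⁴ − 15/(2y⁵) − 23/(2y⁶) − 49/(2y⁷)) → 35`** (`y → ∞`): the EIGHTH coefficient of the strong-adsorption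
expansion of the surface contact density — by `½ − ρ⁺ = (m − V)/(2m)` and the pure forms of `m` (→ 513) and `V` (→ 50):
`35 = (513 − 50 − 2·73 − 3·30 − 6·11 − 15·3 − 23·2 − 49·0)/2`.  Hence **`½ − ρ(log y) = 1/y² + 3/(2y³) + 3/y⁴ + 15/(2y⁵) + 23/(2y⁶) + 49/(2y⁷) + 35/y⁸ + o(y⁻⁸)`**.
[cite: Giacomin2011, Chapter 2, eq. (2.11)] [cite: BeatonBousquetMelouDeGierDuminilCopinGuttmann2014, Section 3.1, Proposition 5 (arXiv v5 p. 9) and p. 10]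
[cite: JansevanRensburgWhittington2013, Section 3.1] [cite: MadrasSlade1993, Section 4.2, Theorem 4.2.2 (pp. 91–92)] -/
theorem tendsto_pow_eight_mul_density_deficit :
    Tendsto (fun y : ℝ => y ^ 8 * (1 / 2 - wallRightDensity (Real.log y) - 1 / y ^ 2 - 3 / (2 * y ^ 3) - 3 / y ^ 4 - 15 / (2 * y ^ 5) -
      23 / (2 * y ^ 6) - 49 / (2 * y ^ 7))) atTop (𝓝 35) := by
  have hA := tendsto_pow_eight_mul_pwbMean_sub_seven_terms
  have hB := tendsto_pow_eight_mul_pwbVisitMean_sub_one_sub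
  have hC6 := tendsto_pow_six_mul_pwbMean_sub_five_terms
  have hC5 := tendsto_pow_five_mul_pwbMean_sub_four_terms
  have hC4 := tendsto_pow_four_mul_pwbMean_sub_one_sub_sub
  have hC3 := tendsto_cube_mul_pwbMean_sub_one_sub_two_div_sq
  have hD := tendsto_sq_mul_pwbMean_sub_one
  have hE := tendsto_mul_pwbMean_sub_one_em
  have hm := tendsto_pwbMean_em
  have h := (((((((hA.sub hB).sub (hC6.const_mul 2)).sub (hC5.const_mul 3)).sub (hC4.const_mul 6)).sub (hC3.const_mul 15)).sub
    (hD.const_mul 23)).sub (hE.const_mul 49)).div (hm.const_mul 2) (by norm_num)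
  refine Tendsto.congr' ?_ (tendsto_of_tendsto_of_eq_em h (by norm_num))
  filter_upwards [eventually_gt_atTop (hexConnectiveConstant ^ 4)] with y hy
  have hy0 : 0 < y := lt_of_le_of_lt (by positivity) hy
  have hm0 : pwbMean y ≠ 0 := (pwbMean_pos hy).ne'
  have hid := pwbMean_sub_pwbVisitMean_eq hy
  have hy' : y ≠ 0 := hy0.ne'
  simp only [Pi.div_apply]
  rw [div_eq_iff (mul_ne_zero two_ne_zero hm0)]
  have e2 : y ^ 8 * (1 / 2 - wallRightDensity (Real.log y) - 1 / y ^ 2 - 3 / (2 * y ^ 3) - 3 / y ^ 4 - 15 / (2 * y ^ 5) - 23 / (2 * y ^ 6) -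
        49 / (2 * y ^ 7)) * (2 * pwbMean y) =
      y ^ 8 * (2 * pwbMean y * (1 / 2 - wallRightDensity (Real.log y))) - 2 * pwbMean y * y ^ 6 - 3 * pwbMean y * y ^ 5 -
        6 * pwbMean y * y ^ 4 - 15 * pwbMean y * y ^ 3 - 23 * pwbMean y * y ^ 2 - 49 * pwbMean y * y := by
    field_simp
    ring
  rw [e2, ← hid]
  field_simp
  ring

/-- ★★ **The same for the left density** (no kink on `eᵗ > μ⁴`). [cite: Giacomin2011, Chapter 2, eq. (2.11)] [cite: JansevanRensburgWhittington2013, Section 3.1, eq. (3.4)] -/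
theorem tendsto_pow_eight_mul_density_deficit_left :
    Tendsto (fun y : ℝ => y ^ 8 * (1 / 2 - wallLeftDensity (Real.log y) - 1 / y ^ 2 - 3 / (2 * y ^ 3) - 3 / y ^ 4 - 15 / (2 * y ^ 5) -
      23 / (2 * y ^ 6) - 49 / (2 * y ^ 7))) atTop (𝓝 35) := by
  refine tendsto_pow_eight_mul_density_deficit.congr' ?_
  filter_upwards [eventually_gt_atTop (hexConnectiveConstant ^ 4)] with y hy
  have hy0 : 0 < y := lt_of_le_of_lt (by positivity) hy
  have ht : hexConnectiveConstant ^ 4 < Real.exp (Real.log y) := by rwa [Real.exp_log hy0]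
  rw [wallLeftDensity_eq_wallRightDensity ht]

/-- ★★ **`t`-form, eighth order**: `e^{8t} (½ − ρ⁺(t) − e^{−2t} − (3/2)e^{−3t} − 3e^{−4t} − (15/2)e^{−5t} − (23/2)e^{−6t} − (49/2)e^{−7t}) → 35` (`t → ∞`).
[cite: BeatonBousquetMelouDeGierDuminilCopinGuttmann2014, Section 3.1, Proposition 5 (arXiv v5 p. 9) and p. 10] [cite: Giacomin2011, Chapter 2, eq. (2.11)] -/
theorem tendsto_exp_eight_mul_deficit :
    Tendsto (fun t : ℝ => Real.exp (8 * t) * (1 / 2 - wallRightDensity t - Real.exp (-(2 * t)) - 3 / 2 * Real.exp (-(3 * t)) -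
      3 * Real.exp (-(4 * t)) - 15 / 2 * Real.exp (-(5 * t)) - 23 / 2 * Real.exp (-(6 * t)) - 49 / 2 * Real.exp (-(7 * t)))) atTop (𝓝 35) := by
  have h := tendsto_pow_eight_mul_density_deficit.comp Real.tendsto_exp_atTop
  refine h.congr' ?_
  filter_upwards [eventually_gt_atTop (0 : ℝ)] with t ht
  simp only [Function.comp_def, Real.log_exp]
  have e8 : Real.exp t ^ 8 = Real.exp (8 * t) := by rw [← Real.exp_nat_mul]; norm_num
  have e2 : (1 : ℝ) / Real.exp t ^ 2 = Real.exp (-(2 * t)) := by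
    rw [Real.exp_neg, ← Real.exp_nat_mul, one_div]; norm_num
  have e3 : (3 : ℝ) / (2 * Real.exp t ^ 3) = 3 / 2 * Real.exp (-(3 * t)) := by
    rw [Real.exp_neg, ← Real.exp_nat_mul]; push_cast; field_simp
  have e4 : (3 : ℝ) / Real.exp t ^ 4 = 3 * Real.exp (-(4 * t)) := by
    rw [Real.exp_neg, ← Real.exp_nat_mul]; push_cast; field_simp
  have e5 : (15 : ℝ) / (2 * Real.exp t ^ 5) = 15 / 2 * Real.exp (-(5 * t)) := by
    rw [Real.exp_neg, ← Real.exp_nat_mul]; push_cast; field_simp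
  have e6 : (23 : ℝ) / (2 * Real.exp t ^ 6) = 23 / 2 * Real.exp (-(6 * t)) := by
    rw [Real.exp_neg, ← Real.exp_nat_mul]; push_cast; field_simp
  have e7 : (49 : ℝ) / (2 * Real.exp t ^ 7) = 49 / 2 * Real.exp (-(7 * t)) := by
    rw [Real.exp_neg, ← Real.exp_nat_mul]; push_cast; field_simp
  rw [e8, e2, e3, e4, e5, e6, e7]

/-- ★ **Asymptotic equivalence** `½ − ρ⁺(log y) − 1/y² − 3/(2y³) − 3/y⁴ − 15/(2y⁵) − 23/(2y⁶) − 49/(2y⁷) ∼ 35/y⁸`. [cite: Giacomin2011, Chapter 2, eq. (2.11)]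
[cite: BeatonBousquetMelouDeGierDuminilCopinGuttmann2014, Section 3.1, Proposition 5 (arXiv v5 p. 9) and p. 10] -/
theorem isEquivalent_density_deficit_eighth :
    (fun y : ℝ => 1 / 2 - wallRightDensity (Real.log y) - 1 / y ^ 2 - 3 / (2 * y ^ 3) - 3 / y ^ 4 - 15 / (2 * y ^ 5) - 23 / (2 * y ^ 6) -
      49 / (2 * y ^ 7)) ~[atTop] fun y : ℝ => 35 / y ^ 8 := by
  have hz : ∀ᶠ y : ℝ in atTop, (35 : ℝ) / y ^ 8 ≠ 0 := by
    filter_upwards [eventually_gt_atTop (0 : ℝ)] with y hy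
    positivity
  refine (isEquivalent_iff_tendsto_one hz).2 ?_
  have h := tendsto_pow_eight_mul_density_deficit.div_const 35
  rw [show ((35 : ℝ) / 35) = 1 by norm_num] at h
  refine h.congr' ?_
  filter_upwards [eventually_gt_atTop (0 : ℝ)] with y hy
  simp only [Pi.div_apply]
  have hy' : y ≠ 0 := hy.ne'
  field_simp

end Literature.Probability.RandomPlanarGeometry.SAW.HexBW.Wall

end
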